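import Literature.Geometry.Symplectic.LefschetzSteinOpenBookReeb
import Literature.Geometry.Symplectic.LefschetzSteinOpenBookBaseCase
import Literature.Geometry.Symplectic.LefschetzBaseSteinModel
import HarnessLib

/-!
# PALF ⇒ Stein with supported boundary open book, handle-free case: from a flat
# Reeb-compatible Stein model of the base to the conclusion of the named fact

Topic `Literature/Geometry/Symplectic`; a proofs-only companion (auxiliary definitions, no named
fact) of `LefschetzSteinOpenBook.lean` (the named fact
`Literature.Geometry.Symplectic.palf_stein_supportedByBoundaryOpenBook`, Akbulut–Ozbagci 2001,
Thm. 5; its first step, Torisu 2000 / Etnyre 2006 Thm. 5.6 ¶1: *"`X₀ = D² × F` is Stein and its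
boundary open book supports the boundary contact structure"*) and of its reduction
`palf_stein_supportedByBoundaryOpenBook_of_reebModels` (`LefschetzSteinOpenBookReeb.lean`).

**Main result.**  `palf_conclusion_of_flatReebModel`: let `X_Ψ = {Ψ ≤ c} ⊂ ℂ²` be a compact
regular sublevel set carrying a Stein structure `S` in normal form (`S.J = sublevelJ hΨ J₀`,
`S.φ = sublevelPhi hΨ`, `SteinOneHandlebodies.lean` §4; produced by
`LefschetzBaseSteinModel.lean` and by `LefschetzBaseModelStein.exists_steinStructure_model`), let
`e : Base g ≅ X_Ψ` be a diffeomorphism covering a diffeomorphism `Φ` of `ℂ²` which carries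
`{rho ≤ 1/4}`, `{rho = 1/4}` onto `{Ψ ≤ c}`, `{Ψ = c}`, multiplies `w = y² - x^{2g+1} - 1` by a
positive function and has positive Jacobian determinant
(`LefschetzBaseModelIdentification.lean`, `LefschetzBaseModelOrientation.lean`), and let
`R : ℂ² → ℂ²` satisfy, at every point `z` of the level `{Ψ = c}`, the FLAT Reeb conditions
(F0) `dΨ(R) = 0`; (F1) `-dΨ(J₀ R) > 0`; (F2) `dd^ℂΨ(R, v) = 0` for all `v ∈ ker dΨ`;
(F3) `Im(w̄ · dw(R)) > 0` where `w ≠ 0`; (F4) where `w = 0`: every `v ∈ ker dΨ ∩ ker dw` is a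
multiple of `R` (so `R` spans the tangent line of the binding); (F5) where `w = 0`:
`-dd^ℂΨ(e₁, e₂) > 0` for `e₁, e₂ ∈ ker dΨ` with `Im(conj(dw e₁) dw e₂) > 0`.
Then for EVERY handle-free family `h : ι → …` (`IsEmpty ι`), every compact multi-attachment
`(X, D)` of `h`, boundary datum `bX` and Kas open book `ob` (`IsKasOpenBookOf`), the conclusion
of the named fact holds: a Stein structure on `X` with a Giroux form of `ob` for its complex
tangencies, positive for the complex boundary orientation.  (For the fields `R = J₀ X`, `X` the
gradient of `Ψ` for the Levi metric, (F0)–(F2) are identities and (F3)–(F5) are pointwise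
inequalities of `Ψ` alone.)

**Contents.**
* §1 `det4_eq_det`, `det4_linearMap` — the volume form `det4` of `LefschetzSteinOpenBook.lean`
  is the determinant in the standard basis, `det4 ∘ A = det A · det4`; the standard basis is
  `J₀`-adapted and `(Dι)⁻¹` of it is adapted to `J = (Dι)⁻¹ J₀ Dι` (`isAdaptedBasis_map_symm`,
  `det_map_symm`);
* §2 `bdDeriv hΨ y = Dι ∘ d(incl_∂)` — the differential of `∂X_Ψ → X_Ψ → ℝ⁴` at a point `y` of
  the boundary manifold: injective with image `ker dΨ` (`range_bdDeriv`), differentials of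
  functions constant on the level vanish on it (`fderiv_apply_bdDeriv_of_const`), and the lift
  `bdLift` of a level-tangent vector;
* §3 for `S` in normal form: `β_S(u) = -dΨ(J₀ L u)`, `dβ_S(u, v) = -dd^ℂΨ(L u, L v)`
  (`boundaryContactForm_flat`, `mextDeriv_boundaryContactForm_flat`), `S.dφ`, `S.J` through
  `Dι`, an adapted basis (`isAdaptedBasis_flat`);
* §4 `angularDeriv_of_phase` — `dθ_y(v) = Im(conj(W y) dW(v))/‖W y‖²` for a map to the circle
  which is the phase of a complex function `W` near `y`;
* §5 the model `(X_Ψ, D₀, ∂X_Ψ, ob₀)`: `D₀.jA = e ∘ incl` (`flatModelData`), `ob₀ = (∂e)_* ob_Kas`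
  (`flatOB`, `isKasOpenBookOf_flatModel` by `IsKasOpenBookOf.map`); `ι ∘ ∂e = Φ ∘ ι_B`, the binding
  of `ob₀` is `{w ∘ ι = 0}` and its fibration is the phase of `w ∘ ι`;
* §6 the lifted field `reebLift = L⁻¹ (R ∘ ι)` and the five hypotheses of
  `SteinStructure.isGirouxForm_boundaryContactForm_of_reebField`: (R1), (R2) by §3; (R3) by §4;
  (R4) tangency to the binding from (F4) (`w ∘ ι ∘ tube₀(·, 0) = 0`); (R5) positivity on the
  meridional frame from (F5), the orientation of `(dw L e₁, dw L e₂) = (a, i a)`, `a > 0`, being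
  read off `w ∘ ι ∘ tube₀ (x, v) = r · wsc(v) · v` by the first-order direction lemma
  `fderiv_apply_direction_of_eventually` and the dimension count `dim ker dΨ = 3`;
* §7 the orientation clause: `d(D₀.jA)` carries positive boundary frames of `∂ Base g`
  (`IsPosBdryFrame`, `det4(∇rho, v) > 0`) to frames positive for the complex orientation,
  via `Dι ∘ d(e ∘ incl) = DΦ ∘ ambientC`, `det4 ∘ DΦ = det DΦ · det4`, and the outward vector
  `DΦ(∇rho)` (`fderiv_apply_diffeo_gradient_pos`: sign from `Φ{rho ≤ 1/4} = {Ψ ≤ c}`,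
  non-vanishing from `Φ{rho = 1/4} = {Ψ = c}`, `DΦ` onto, `dΨ ≠ 0`);
* §8 assembly by `palf_conclusion_of_model` (`LefschetzSteinOpenBookTransport.lean`).

## References

* S. Akbulut, B. Ozbagci, *Lefschetz fibrations on compact Stein surfaces*, Geom. Topol. 5
  (2001), Thm. 5 and its proof, first step (arXiv:math/0012239, p. 8). [AkbulutOzbagci2001]
* I. Torisu, *Convex contact structures and fibered links in 3-manifolds*, IMRN 2000:9,
  441–454. [Torisu2000]
* J. B. Etnyre, *Lectures on open book decompositions and contact structures*, Clay Math. Proc.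
  5 (2006), Lemma 3.3, Thm. 5.6 (arXiv:math/0409402). [Etnyre2006]
* K. Cieliebak, Ya. Eliashberg, *From Stein to Weinstein and Back*, AMS Coll. Publ. 59 (2012),
  Ch. 2 (`i`-convex sublevel sets, `-d^ℂφ`). [CieliebakEliashberg2012]
-/

noncomputable section

open scoped Manifold ContDiff Topology ComplexConjugate
open Set Function Module Filter Complex
open Literature.Geometry.Kaehler Literature.Topology.FourManifolds
  Literature.Topology.FourManifolds.HandleAttachingMap Literature.Topology.FourManifolds.LefschetzBase

namespace Literature.Geometry.Symplectic

/-- Local notation: `E4` is `EuclideanSpace ℝ (Fin 4) = ℝ⁴ = ℂ²`. -/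
local notation "E4" => EuclideanSpace ℝ (Fin 4)
/-- Local notation: `E3` is `EuclideanSpace ℝ (Fin 3)`. -/
local notation "E3" => EuclideanSpace ℝ (Fin 3)
/-- Local notation: `E2` is `EuclideanSpace ℝ (Fin 2)`. -/
local notation "E2" => EuclideanSpace ℝ (Fin 2)
/-- Local notation: `E1` is `EuclideanSpace ℝ (Fin 1)`. -/
local notation "E1" => EuclideanSpace ℝ (Fin 1)

/-! ### §1 The volume form `det4`, the standard basis and adapted bases -/

/-- **`det4` is the determinant in the standard basis of `ℝ⁴`.** [folklore] -/
theorem det4_eq_det (a b c d : E4) :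
    det4 a b c d = (PiLp.basisFun 2 ℝ (Fin 4)).det ![a, b, c, d] := by
  rw [Basis.det_apply, det4]
  have hM : (PiLp.basisFun 2 ℝ (Fin 4)).toMatrix ![a, b, c, d] =
      (Matrix.of fun i j : Fin 4 => (![a, b, c, d] i) j).transpose := by
    ext i j
    simp [Basis.toMatrix_apply, Matrix.transpose_apply]
  rw [hM, Matrix.det_transpose]

/-- **`det4` is multiplied by `det A` under a linear map `A`.** [folklore] -/
theorem det4_linearMap (A : E4 →ₗ[ℝ] E4) (a b c d : E4) :
    det4 (A a) (A b) (A c) (A d) = LinearMap.det A * det4 a b c d := by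
  rw [det4_eq_det, det4_eq_det, ← Basis.det_comp]
  congr 1
  funext i
  fin_cases i <;> rfl

/-- **The standard basis of `ℝ⁴ = ℂ²` is `J₀`-adapted**: `e₁ = J₀ e₀`, `e₃ = J₀ e₂`
(`J₀ (x₀, x₁, x₂, x₃) = (-x₁, x₀, -x₃, x₂)`). [folklore] -/
theorem isAdaptedBasis_basisFun :
    ComplexStructure.IsAdaptedBasis
      ((stdComplexStructure : E4 →L[ℝ] E4) : E4 →ₗ[ℝ] E4) (PiLp.basisFun 2 ℝ (Fin 4)) := by
  constructor
  · ext i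
    fin_cases i <;> simp [PiLp.basisFun_apply]
  · ext i
    fin_cases i <;> simp [PiLp.basisFun_apply]

/-- **Transport of the standard basis by `D⁻¹` is adapted to `D⁻¹ J₀ D`.** [folklore] -/
theorem isAdaptedBasis_map_symm (D : E4 ≃L[ℝ] E4) :
    ComplexStructure.IsAdaptedBasis
      ((((D.symm : E4 ≃L[ℝ] E4) : E4 →L[ℝ] E4).comp
        ((stdComplexStructure : E4 →L[ℝ] E4).comp (D : E4 →L[ℝ] E4)) : E4 →L[ℝ] E4) :
          E4 →ₗ[ℝ] E4)
      ((PiLp.basisFun 2 ℝ (Fin 4)).map (D.symm : E4 ≃L[ℝ] E4).toLinearEquiv) := by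
  obtain ⟨h1, h3⟩ := isAdaptedBasis_basisFun
  constructor
  · simp only [Basis.map_apply, ContinuousLinearEquiv.coe_toLinearEquiv,
      ContinuousLinearMap.coe_coe, ContinuousLinearMap.coe_comp, comp_apply,
      ContinuousLinearEquiv.coe_coe, ContinuousLinearEquiv.apply_symm_apply]
    rw [h1]; rfl
  · simp only [Basis.map_apply, ContinuousLinearEquiv.coe_toLinearEquiv,
      ContinuousLinearMap.coe_coe, ContinuousLinearMap.coe_comp, comp_apply,
      ContinuousLinearEquiv.coe_coe, ContinuousLinearEquiv.apply_symm_apply]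
    rw [h3]; rfl

/-- **The determinant in the transported basis is `det4` of the `D`-images.** [folklore] -/
theorem det_map_symm (D : E4 ≃L[ℝ] E4) (v : Fin 4 → E4) :
    ((PiLp.basisFun 2 ℝ (Fin 4)).map (D.symm : E4 ≃L[ℝ] E4).toLinearEquiv).det v =
      det4 (D (v 0)) (D (v 1)) (D (v 2)) (D (v 3)) := by
  rw [Basis.det_map, det4_eq_det]
  congr 1
  funext i
  fin_cases i <;> rfl

/-! ### §2 The differential of `∂X_Ψ → ℝ⁴` and the lift of level-tangent vectors -/

section Boundary

variable {Ψ : E4 → ℝ} {c : ℝ} (hΨ : IsRegularLevel (𝓡 4) Ψ c)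

/-- The ambient point `ι(y) ∈ ℝ⁴` of a point `y` of the boundary manifold `∂X_Ψ`. [folklore] -/
def bdPt (y : (RegularSublevel.boundaryData hΨ).carrier) : E4 :=
  RegularSublevel.incl hΨ y.1

/-- Boundary points lie on the level: `Ψ(ι y) = c`. [folklore] -/
theorem apply_bdPt (y : (RegularSublevel.boundaryData hΨ).carrier) : Ψ (bdPt hΨ y) = c :=
  RegularSublevel.apply_incl_boundary hΨ y

/-- **`L_y = Dι ∘ d(incl_∂)_y : ℝ³ → ℝ⁴`**, the differential at `y` of the composite inclusion
`∂X_Ψ → X_Ψ → ℝ⁴` (the second factor read through `inclDeriv`). [folklore] -/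
def bdDeriv (y : (RegularSublevel.boundaryData hΨ).carrier) : E3 →L[ℝ] E4 :=
  (inclDeriv hΨ y.1 : E4 →L[ℝ] E4).comp
    (mfderiv (𝓡 3) (𝓡∂ 4) (RegularSublevel.boundaryData hΨ).incl y)

/-- Unfolding `bdDeriv`. [folklore] -/
theorem bdDeriv_apply (y : (RegularSublevel.boundaryData hΨ).carrier) (u : E3) :
    bdDeriv hΨ y u =
      inclDeriv hΨ y.1 (mfderiv (𝓡 3) (𝓡∂ 4) (RegularSublevel.boundaryData hΨ).incl y u) :=
  rfl

/-- `L_y` is injective (both factors are). [folklore] -/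
theorem bdDeriv_injective (y : (RegularSublevel.boundaryData hΨ).carrier) :
    Injective (bdDeriv hΨ y) := by
  have hinj : Injective (mfderiv (𝓡 3) (𝓡∂ 4) (RegularSublevel.boundaryData hΨ).incl y) :=
    Manifold.IsImmersionAt.mfderiv_injective
      ((RegularSublevel.boundaryData hΨ).isSmoothEmbedding.isImmersion.isImmersionAt y) (by simp)
  exact (inclDeriv hΨ y.1).injective.comp hinj

/-- **`L_y` lands in the tangent space of the level: `dΨ(L_y u) = 0`** (`Ψ ∘ ι ∘ incl_∂ ≡ c`).
[folklore] -/
theorem fderiv_apply_bdDeriv (y : (RegularSublevel.boundaryData hΨ).carrier) (u : E3) :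
    fderiv ℝ Ψ (bdPt hΨ y) (bdDeriv hΨ y u) = 0 := by
  have h1 : MDifferentiableAt (𝓡∂ 4) 𝓘(ℝ, ℝ) (sublevelPhi hΨ)
      ((RegularSublevel.boundaryData hΨ).incl y) :=
    (contMDiff_sublevelPhi hΨ _).mdifferentiableAt (by simp)
  have h2 : MDifferentiableAt (𝓡 3) (𝓡∂ 4) (RegularSublevel.boundaryData hΨ).incl y :=
    ((RegularSublevel.boundaryData hΨ).isSmoothEmbedding.contMDiff y).mdifferentiableAt (by simp)
  have hc := mfderiv_comp y h1 h2
  have hconst : sublevelPhi hΨ ∘ (RegularSublevel.boundaryData hΨ).incl = fun _ => c :=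
    funext fun z => RegularSublevel.apply_incl_boundary hΨ z
  rw [hconst] at hc
  have h0 : mfderiv (𝓡 3) 𝓘(ℝ, ℝ) (fun _ : (RegularSublevel.boundaryData hΨ).carrier => c) y = 0 :=
    mfderiv_const
  rw [h0] at hc
  have key : mfderiv (𝓡∂ 4) 𝓘(ℝ, ℝ) (sublevelPhi hΨ) ((RegularSublevel.boundaryData hΨ).incl y)
      (mfderiv (𝓡 3) (𝓡∂ 4) (RegularSublevel.boundaryData hΨ).incl y u) = 0 :=
    (DFunLike.congr_fun hc u).symm
  have e1 := mfderiv_sublevelPhi_apply hΨ ((RegularSublevel.boundaryData hΨ).incl y)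
    (mfderiv (𝓡 3) (𝓡∂ 4) (RegularSublevel.boundaryData hΨ).incl y u)
  rw [key] at e1
  exact e1.symm

/-- **A function constant on the level has differential vanishing on the image of `L_y`.**
[folklore] -/
theorem fderiv_apply_bdDeriv_of_const {F : Type*} [NormedAddCommGroup F] [NormedSpace ℝ F]
    {f : E4 → F} (hf : Differentiable ℝ f) {k : F}
    (hk : ∀ y : (RegularSublevel.boundaryData hΨ).carrier, f (bdPt hΨ y) = k)
    (y : (RegularSublevel.boundaryData hΨ).carrier) (u : E3) :
    fderiv ℝ f (bdPt hΨ y) (bdDeriv hΨ y u) = 0 := by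
  have h1 : HasMFDerivAt (𝓡 4) 𝓘(ℝ, F) f (bdPt hΨ y) (fderiv ℝ f (bdPt hΨ y)) :=
    (hf _).hasFDerivAt.hasMFDerivAt
  have h2 : HasMFDerivAt (𝓡∂ 4) (𝓡 4) (RegularSublevel.incl hΨ) y.1
      (inclDeriv hΨ y.1 : E4 →L[ℝ] E4) := by
    rw [coe_inclDeriv]
    exact ((contMDiff_incl_four hΨ y.1).mdifferentiableAt (by simp)).hasMFDerivAt
  have h3 : HasMFDerivAt (𝓡 3) (𝓡∂ 4) (RegularSublevel.boundaryData hΨ).incl y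
      (mfderiv (𝓡 3) (𝓡∂ 4) (RegularSublevel.boundaryData hΨ).incl y) :=
    (((RegularSublevel.boundaryData hΨ).isSmoothEmbedding.contMDiff y).mdifferentiableAt
      (by simp)).hasMFDerivAt
  have hc : HasMFDerivAt (𝓡 3) 𝓘(ℝ, F)
      (f ∘ (RegularSublevel.incl hΨ ∘ (RegularSublevel.boundaryData hΨ).incl)) y
      (((fderiv ℝ f (bdPt hΨ y)).comp (bdDeriv hΨ y) : E3 →L[ℝ] F)) :=
    h1.comp y (h2.comp y h3)
  have hconst : (f ∘ (RegularSublevel.incl hΨ ∘ (RegularSublevel.boundaryData hΨ).incl)) =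
      fun _ => k := funext fun z => hk z
  rw [hconst] at hc
  have h0 := hc.mfderiv.symm.trans (hasMFDerivAt_const (I := 𝓡 3) (I' := 𝓘(ℝ, F)) k y).mfderiv
  exact DFunLike.congr_fun h0 u

/-- `dΨ ≠ 0` at boundary points. [folklore] -/
theorem fderiv_bdPt_ne_zero (y : (RegularSublevel.boundaryData hΨ).carrier) :
    fderiv ℝ Ψ (bdPt hΨ y) ≠ 0 := by
  intro h0
  have h1 := mfderiv_sublevelPhi_ne_zero hΨ (x := y.1) y.2
  apply h1
  rw [mfderiv_sublevelPhi]
  have h0' : fderiv ℝ Ψ (RegularSublevel.incl hΨ y.1) = 0 := h0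
  rw [h0', ContinuousLinearMap.zero_comp]
  rfl

/-- `dim ker dΨ = 3` at boundary points. [folklore] -/
theorem finrank_ker_fderiv_bdPt (y : (RegularSublevel.boundaryData hΨ).carrier) :
    finrank ℝ (LinearMap.ker ((fderiv ℝ Ψ (bdPt hΨ y) : E4 →L[ℝ] ℝ) : E4 →ₗ[ℝ] ℝ)) = 3 := by
  set ℓ : E4 →ₗ[ℝ] ℝ := ((fderiv ℝ Ψ (bdPt hΨ y) : E4 →L[ℝ] ℝ) : E4 →ₗ[ℝ] ℝ) with hℓ
  have hsurj : Function.Surjective ℓ := by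
    have hne : ℓ ≠ 0 := by
      intro h0
      apply fderiv_bdPt_ne_zero hΨ y
      ext v
      exact DFunLike.congr_fun h0 v
    obtain ⟨v, hv⟩ : ∃ v, ℓ v ≠ 0 := by
      by_contra h
      push Not at h
      exact hne (LinearMap.ext h)
    intro r
    refine ⟨(r / ℓ v) • v, ?_⟩
    rw [map_smul, smul_eq_mul, div_mul_cancel₀ r hv]
  have h := ℓ.finrank_range_add_finrank_ker
  rw [LinearMap.range_eq_top.2 hsurj, finrank_top, finrank_self, finrank_euclideanSpace_fin] at h
  omega

/-- **The image of `L_y` is the whole tangent space `ker dΨ` of the level** (dimension count).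
[folklore] -/
theorem range_bdDeriv (y : (RegularSublevel.boundaryData hΨ).carrier) :
    LinearMap.range ((bdDeriv hΨ y : E3 →L[ℝ] E4) : E3 →ₗ[ℝ] E4) =
      LinearMap.ker ((fderiv ℝ Ψ (bdPt hΨ y) : E4 →L[ℝ] ℝ) : E4 →ₗ[ℝ] ℝ) := by
  refine Submodule.eq_of_le_of_finrank_eq ?_ ?_
  · rintro v ⟨u, rfl⟩
    exact fderiv_apply_bdDeriv hΨ y u
  · have hinj : Injective ((bdDeriv hΨ y : E3 →L[ℝ] E4) : E3 →ₗ[ℝ] E4) := bdDeriv_injective hΨ y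
    rw [LinearMap.finrank_range_of_inj hinj, finrank_euclideanSpace_fin, finrank_ker_fderiv_bdPt]

/-- Every level-tangent ambient vector is an `L_y`-image. [folklore] -/
theorem exists_bdDeriv_eq (y : (RegularSublevel.boundaryData hΨ).carrier) {V : E4}
    (hV : fderiv ℝ Ψ (bdPt hΨ y) V = 0) : ∃ u : E3, bdDeriv hΨ y u = V := by
  have hV' : V ∈ LinearMap.ker ((fderiv ℝ Ψ (bdPt hΨ y) : E4 →L[ℝ] ℝ) : E4 →ₗ[ℝ] ℝ) := hV
  rw [← range_bdDeriv] at hV'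
  obtain ⟨u, hu⟩ := hV'
  exact ⟨u, hu⟩

/-- **The lift `L_y⁻¹ V ∈ ℝ³` of a level-tangent ambient vector `V`** (junk `0` if `V` is not
tangent). [folklore] -/
def bdLift (y : (RegularSublevel.boundaryData hΨ).carrier) (V : E4) : E3 :=
  if hV : fderiv ℝ Ψ (bdPt hΨ y) V = 0 then Classical.choose (exists_bdDeriv_eq hΨ y hV) else 0

/-- Defining property of the lift: `L_y (L_y⁻¹ V) = V`. [folklore] -/
theorem bdDeriv_bdLift (y : (RegularSublevel.boundaryData hΨ).carrier) {V : E4}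
    (hV : fderiv ℝ Ψ (bdPt hΨ y) V = 0) : bdDeriv hΨ y (bdLift hΨ y V) = V := by
  rw [bdLift, dif_pos hV]
  exact Classical.choose_spec (exists_bdDeriv_eq hΨ y hV)

/-- `L_y u = V` forces `u = L_y⁻¹ V`. [folklore] -/
theorem eq_bdLift_of_bdDeriv_eq (y : (RegularSublevel.boundaryData hΨ).carrier) {u : E3} {V : E4}
    (h : bdDeriv hΨ y u = V) : u = bdLift hΨ y V := by
  have hV : fderiv ℝ Ψ (bdPt hΨ y) V = 0 := by rw [← h]; exact fderiv_apply_bdDeriv hΨ y u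
  exact bdDeriv_injective hΨ y (h.trans (bdDeriv_bdLift hΨ y hV).symm)

end Boundary

/-! ### §3 The canonical boundary form of a flat Stein structure, read flat -/

section FlatStein

variable {Ψ : E4 → ℝ} {c : ℝ} (hΨ : IsRegularLevel (𝓡 4) Ψ c)
  [CompactSpace (RegularSublevel hΨ)] (S : SteinStructure (RegularSublevel hΨ))
  (hSJ : S.J = sublevelJ hΨ stdComplexStructure) (hSφ : S.φ = sublevelPhi hΨ)

include hSφ in
/-- `dφ` of a flat Stein structure through `Dι`: `dφ_x(v) = dΨ_{ι x}(Dι v)`. [folklore] -/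
theorem dφ_flat (x : RegularSublevel hΨ) (v : E4) :
    S.dφ x v = fderiv ℝ Ψ (RegularSublevel.incl hΨ x) (inclDeriv hΨ x v) := by
  show mfderiv (𝓡∂ 4) 𝓘(ℝ, ℝ) S.φ x v = _
  rw [hSφ]
  exact mfderiv_sublevelPhi_apply hΨ x v

include hSJ in
/-- `J` of a flat Stein structure through `Dι`: `Dι (J_x v) = J₀ (Dι v)`. [folklore] -/
theorem inclDeriv_J_flat (x : RegularSublevel hΨ) (v : E4) :
    inclDeriv hΨ x (S.J x v) = stdComplexStructure (inclDeriv hΨ x v) := by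
  rw [hSJ, inclDeriv_sublevelJ]

include hSJ hSφ in
/-- **`β_S(u) = -dΨ(J₀ L_y u)`.** [cite: CieliebakEliashberg2012, Ch. 2] -/
theorem boundaryContactForm_flat (y : (RegularSublevel.boundaryData hΨ).carrier) (u : E3) :
    S.boundaryContactForm (RegularSublevel.boundaryData hΨ) y ![u] =
      -(fderiv ℝ Ψ (bdPt hΨ y) (stdComplexStructure (bdDeriv hΨ y u))) := by
  have h := (liouvilleForm_pullback S
    (RegularSublevel.boundaryData hΨ).isSmoothEmbedding.contMDiff).2.1 y u
  rw [SteinStructure.boundaryContactForm, h, SteinStructure.contactForm_apply, dφ_flat hΨ S hSφ,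
    inclDeriv_J_flat hΨ S hSJ]
  rfl

include hSJ hSφ in
/-- **`dβ_S(u, v) = -dd^ℂΨ(L_y u, L_y v)`.** [cite: CieliebakEliashberg2012, Ch. 2] -/
theorem mextDeriv_boundaryContactForm_flat (y : (RegularSublevel.boundaryData hΨ).carrier)
    (u v : E3) :
    mextDeriv (S.boundaryContactForm (RegularSublevel.boundaryData hΨ)) y ![u, v] =
      -(extDeriv (dComplexFlat stdComplexStructure Ψ) (bdPt hΨ y)
        ![bdDeriv hΨ y u, bdDeriv hΨ y v]) := by
  have h := (liouvilleForm_pullback S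
    (RegularSublevel.boundaryData hΨ).isSmoothEmbedding.contMDiff).2.2 y u v
  rw [SteinStructure.boundaryContactForm, h, SteinStructure.kahlerForm, hSJ, hSφ,
    mextDeriv_dComplex_sublevel]
  have hv : (fun i => (inclDeriv hΨ y.1 : E4 →L[ℝ] E4)
      ((![mfderiv (𝓡 3) (𝓡∂ 4) (RegularSublevel.boundaryData hΨ).incl y u,
          mfderiv (𝓡 3) (𝓡∂ 4) (RegularSublevel.boundaryData hΨ).incl y v] : Fin 2 → E4) i)) =
      ![bdDeriv hΨ y u, bdDeriv hΨ y v] := by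
    funext i
    fin_cases i <;> rfl
  rw [← hv]
  rfl

include hSJ in
/-- **An adapted basis for `S.J` at `x`**: `(Dι_x)⁻¹` of the standard basis. [folklore] -/
theorem isAdaptedBasis_flat (x : RegularSublevel hΨ) :
    ComplexStructure.IsAdaptedBasis (S.J x : E4 →ₗ[ℝ] E4)
      ((PiLp.basisFun 2 ℝ (Fin 4)).map ((inclDeriv hΨ x).symm : E4 ≃L[ℝ] E4).toLinearEquiv) := by
  have h := isAdaptedBasis_map_symm (inclDeriv hΨ x)
  have hJ : (S.J x : E4 →L[ℝ] E4) =
      (((inclDeriv hΨ x).symm : E4 ≃L[ℝ] E4) : E4 →L[ℝ] E4).comp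
        ((stdComplexStructure : E4 →L[ℝ] E4).comp (inclDeriv hΨ x : E4 →L[ℝ] E4)) := by
    rw [hSJ]; rfl
  rw [hJ]
  exact h

end FlatStein

/-! ### §4 The angular differential of the phase of a complex function -/

section Phase

variable {M : Type*} [TopologicalSpace M] [ChartedSpace E3 M]

/-- The radial projection `q ↦ q/‖q‖` of `ℝ² ∖ {0}` onto the circle has derivative
`‖q‖⁻¹ · id + (d‖·‖⁻¹) ⊗ q`; the angle form at `q/‖q‖` kills the second term:
`dφ_{q/‖q‖}(dΠ_q η) = ‖q‖⁻² (q₀ η₁ - q₁ η₀)`. [folklore] -/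
theorem angleForm_fderiv_radialProj {q : E2} (hq : q ≠ 0) (η : E2) :
    angleForm (‖q‖⁻¹ • q) (fderiv ℝ (fun p : E2 => ‖p‖⁻¹ • p) q η) =
      (‖q‖ ^ 2)⁻¹ * (q 0 * η 1 - q 1 * η 0) := by
  have hd : DifferentiableAt ℝ (fun p : E2 => ‖p‖⁻¹) q :=
    ((contDiffAt_norm (n := 1) ℝ hq).differentiableAt one_ne_zero).inv (norm_ne_zero_iff.2 hq)
  have hP : HasFDerivAt (fun p : E2 => ‖p‖⁻¹ • p)
      (‖q‖⁻¹ • ContinuousLinearMap.id ℝ E2 + (fderiv ℝ (fun p : E2 => ‖p‖⁻¹) q).smulRight q) q := by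
    exact hd.hasFDerivAt.smul (hasFDerivAt_id q)
  rw [hP.fderiv]
  simp only [add_apply, FunLike.coe_smul, Pi.smul_apply,
    ContinuousLinearMap.id_apply, ContinuousLinearMap.smulRight_apply, map_add, map_smul,
    smul_eq_mul, angleForm_apply, PiLp.smul_apply]
  have hn : ‖q‖ ≠ 0 := norm_ne_zero_iff.2 hq
  field_simp
  ring

/-- **`dθ` of a phase.**  Let `θ : M → 𝕊¹` agree near `y` with the phase `W/‖W‖` of a complex
function `W` (read in `ℝ²` through `vec2`), `W` differentiable at `y` with derivative `dW` and
`W y ≠ 0`.  Then `dθ_y(v) = Im(conj(W y) · dW(v)) / ‖W y‖²`. [folklore] -/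
theorem angularDeriv_of_phase (θ : M → Metric.sphere (0 : E2) 1) (W : M → ℂ) (y : M)
    {dW : E3 →L[ℝ] ℂ} (hW : HasMFDerivAt (𝓡 3) 𝓘(ℝ, ℂ) W y dW) (hy : W y ≠ 0)
    (hθ : ∀ᶠ z in 𝓝 y, ((θ z : Metric.sphere (0 : E2) 1) : E2) =
      ‖W z‖⁻¹ • LefschetzBase.vec2 (W z)) (v : E3) :
    angularDeriv θ y v = (conj (W y) * dW v).im / ‖W y‖ ^ 2 := by
  set G : M → E2 := fun z => LefschetzBase.vec2 (W z) with hGdef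
  have hq : G y ≠ 0 := by
    rw [hGdef]; simpa using hy
  -- `G = vec2 ∘ W` and its derivative
  have hG : HasMFDerivAt (𝓡 3) 𝓘(ℝ, E2) G y ((LefschetzBase.vec2L : ℂ →L[ℝ] E2).comp dW) := by
    have h1 : HasMFDerivAt 𝓘(ℝ, ℂ) 𝓘(ℝ, E2) (LefschetzBase.vec2L : ℂ → E2) (W y)
        (LefschetzBase.vec2L : ℂ →L[ℝ] E2) :=
      (LefschetzBase.vec2L.hasFDerivAt (x := W y)).hasMFDerivAt
    exact h1.comp y hW
  -- `θ = Π ∘ G` near `y`, `Π q = q/‖q‖`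
  have hθ' : (fun z => ((θ z : Metric.sphere (0 : E2) 1) : E2)) =ᶠ[𝓝 y]
      (fun p : E2 => ‖p‖⁻¹ • p) ∘ G := by
    filter_upwards [hθ] with z hz
    rw [hz, comp_apply, hGdef]
    simp
  have hPd : DifferentiableAt ℝ (fun p : E2 => ‖p‖⁻¹ • p) (G y) :=
    (((contDiffAt_norm (n := 1) ℝ hq).differentiableAt one_ne_zero).inv (norm_ne_zero_iff.2 hq)).smul
      differentiableAt_id
  have hF : HasMFDerivAt (𝓡 3) 𝓘(ℝ, E2) (fun z => ((θ z : Metric.sphere (0 : E2) 1) : E2)) y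
      ((fderiv ℝ (fun p : E2 => ‖p‖⁻¹ • p) (G y)).comp
        ((LefschetzBase.vec2L : ℂ →L[ℝ] E2).comp dW)) :=
    (hPd.hasFDerivAt.hasMFDerivAt.comp y hG).congr_of_eventuallyEq hθ'
  rw [angularDeriv_apply, hF.mfderiv, hθ.self_of_nhds]
  have hnorm : ‖W y‖⁻¹ • LefschetzBase.vec2 (W y) = ‖G y‖⁻¹ • G y := by
    rw [hGdef]; simp
  rw [hnorm]
  change angleForm (‖G y‖⁻¹ • G y)
      (fderiv ℝ (fun p : E2 => ‖p‖⁻¹ • p) (G y) (LefschetzBase.vec2L (dW v))) = _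
  rw [angleForm_fderiv_radialProj hq]
  simp only [hGdef, LefschetzBase.vec2L_apply,
    LefschetzBase.vec2_apply_zero, LefschetzBase.vec2_apply_one, LefschetzBase.norm_vec2,
    Complex.mul_im, Complex.conj_re, Complex.conj_im]
  rw [div_eq_inv_mul]
  ring

end Phase

/-- The boundary 3-manifold of the base is Hausdorff (it embeds in `Base g`). [folklore] -/
instance instT2SpaceBBaseCarrier (g : ℕ) : T2Space (bBase g).carrier :=
  (bBase g).isSmoothEmbedding.isEmbedding.t2Space

/-- The boundary 3-manifold of a regular sublevel set of `ℝ⁴` is Hausdorff. [folklore] -/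
instance instT2SpaceBoundaryDataCarrier {Ψ : E4 → ℝ} {c : ℝ} (hΨ : IsRegularLevel (𝓡 4) Ψ c) :
    T2Space (RegularSublevel.boundaryData hΨ).carrier :=
  (RegularSublevel.boundaryData hΨ).isSmoothEmbedding.isEmbedding.t2Space

section Model

variable (g : ℕ) {Ψ : E4 → ℝ} {c : ℝ} (hΨ : IsRegularLevel (𝓡 4) Ψ c)
  (e : Base g ≃ₘ⟮𝓡∂ 4, 𝓡∂ 4⟯ RegularSublevel hΨ)

/-! ### §5 The model multi-attachment `(X_Ψ, e ∘ incl)` and its Kas open book -/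

/-- **The handle-free multi-attachment datum on `X_Ψ`**: base embedding `e ∘ incl`, no handles.
[folklore] -/
def flatModelData {ι : Type} [Finite ι] [IsEmpty ι] (h : ι → HandleAttachingMap 3 2 (Base g)) :
    MultiAttachmentData h (𝓡∂ 4) (RegularSublevel hΨ) where
  disjoint := fun i => isEmptyElim i
  jA := fun a => e (a : Base g)
  jB := fun i => isEmptyElim i
  hjA := (Manifold.IsSmoothEmbedding.of_opens _).diffeomorph_comp e
  hjAo := by
    have : range (fun a : ↥(coresComplement h) => e (a : Base g)) = e '' (coresComplement h : Set (Base g)) := by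
      ext x; simp
    rw [this]
    exact e.toHomeomorph.isOpenMap _ (coresComplement h).isOpen
  hjB := fun i => isEmptyElim i
  cover := by
    refine eq_univ_of_forall fun x => Or.inl ?_
    refine ⟨⟨e.symm x, (mem_coresComplement h).2 fun i => isEmptyElim i⟩, ?_⟩
    simp
  glue := fun i => isEmptyElim i
  disjointB := fun i => isEmptyElim i

/-- The base embedding of the model datum is `e ∘ incl` (definitional). [folklore] -/
@[simp] theorem flatModelData_jA {ι : Type} [Finite ι] [IsEmpty ι]
    (h : ι → HandleAttachingMap 3 2 (Base g)) (a : ↥(coresComplement h)) :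
    (flatModelData g hΨ e h).jA a = e (a : Base g) := rfl

/-- **The transported Kas open book `(∂e)_* ob_Kas` on `∂X_Ψ`.** [folklore] -/
abbrev flatOB : OpenBook (RegularSublevel.boundaryData hΨ).carrier :=
  (boundaryOpenBook g).map ((bBase g).restrictDiffeomorph (RegularSublevel.boundaryData hΨ) e)

/-- **The handle-free multi-attachment datum on `Base g` itself** (base embedding the inclusion)
and its Kas open book `boundaryOpenBook g` (binding `{w = 0}`, fibration `w/‖w‖`;
`LefschetzSteinOpenBookBaseCase.lean` for `ι = Empty`). [folklore] -/
theorem exists_baseData_isKasOpenBookOf {ι : Type} [Finite ι] [IsEmpty ι]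
    (h : ι → HandleAttachingMap 3 2 (Base g)) :
    ∃ D : MultiAttachmentData h (𝓡∂ 4) (Base g),
      (∀ a, D.jA a = (a : Base g)) ∧ IsKasOpenBookOf g h D (bBase g).incl (boundaryOpenBook g) := by
  classical
  have hmem : ∀ a : Base g, a ∈ coresComplement h := fun a =>
    (mem_coresComplement h).2 fun i => isEmptyElim i
  let D : MultiAttachmentData h (𝓡∂ 4) (Base g) :=
    { disjoint := fun i => isEmptyElim i
      jA := Subtype.val
      jB := fun i => isEmptyElim i
      hjA := Manifold.IsSmoothEmbedding.of_opens _
      hjAo := (coresComplement h).isOpenEmbedding'.isOpen_range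
      hjB := fun i => isEmptyElim i
      cover := by
        refine eq_univ_of_forall fun a => Or.inl ?_
        exact ⟨⟨a, hmem a⟩, rfl⟩
      glue := fun i => isEmptyElim i
      disjointB := fun i => isEmptyElim i }
  refine ⟨D, fun a => rfl, ?_, ?_⟩
  · intro y
    rw [mem_binding_boundaryOpenBook_iff]
    constructor
    · intro hw
      exact ⟨⟨(bBase g).incl y, hmem _⟩, rfl, hw⟩
    · rintro ⟨a, ha, hw⟩
      have : (bBase g).incl y = (a : Base g) := ha
      rw [this]
      exact hw
  · intro y a hya hw
    have hya' : (bBase g).incl y = (a : Base g) := hya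
    have hw' : w g ((bBase g).incl y).1 ≠ 0 := by rw [hya']; exact hw
    have hproj := proj_boundaryOpenBook g y hw'
    rw [hya'] at hproj
    show toC (((boundaryOpenBook g).proj y : Metric.sphere (0 : E2) 1) : E2) = _
    rw [hproj, toC_smul, toC_vec2, Complex.ofReal_inv]
    exact (div_eq_inv_mul _ _).symm

/-- **The transported Kas open book `(∂e)_* ob_Kas` on `∂X_Ψ` is the Kas open book of the model
datum.** [cite: Kas1980] -/
theorem isKasOpenBookOf_flatModel {ι : Type} [Finite ι] [IsEmpty ι]
    (h : ι → HandleAttachingMap 3 2 (Base g)) :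
    IsKasOpenBookOf g h (flatModelData g hΨ e h) (RegularSublevel.boundaryData hΨ).incl
      (flatOB g hΨ e) := by
  obtain ⟨D, hD, hK⟩ := exists_baseData_isKasOpenBookOf g h
  have he' : ∀ a, e (D.jA a) = (flatModelData g hΨ e h).jA a := fun a => by rw [hD]; rfl
  exact hK.map e he'

/-! #### Reading `∂X_Ψ` through `Φ`: `ι ∘ ∂e = Φ ∘ ι_B` and `w ∘ ι` -/

variable (Φ : E4 ≃ₘ⟮𝓘(ℝ, E4), 𝓘(ℝ, E4)⟯ E4)
  (he : ∀ p, RegularSublevel.incl hΨ (e p) = Φ (RegularSublevel.incl (isRegularLevel_rho g) p))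

include he in
/-- `ι (∂e y') = Φ (ι_B y')`. [folklore] -/
theorem bdPt_restrictDiffeomorph (y' : (bBase g).carrier) :
    bdPt hΨ ((bBase g).restrictDiffeomorph (RegularSublevel.boundaryData hΨ) e y') =
      Φ (inclB g y') := by
  unfold bdPt
  have h1 : ((bBase g).restrictDiffeomorph (RegularSublevel.boundaryData hΨ) e y').1 =
      e ((bBase g).incl y') :=
    BoundaryData.incl_restrictDiffeomorph (b₁ := bBase g) (b₂ := RegularSublevel.boundaryData hΨ)
      e y'
  rw [h1, he]
  rfl

include he in
/-- `ι y = Φ (ι_B (∂e⁻¹ y))`. [folklore] -/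
theorem bdPt_eq_apply_symm (y : (RegularSublevel.boundaryData hΨ).carrier) :
    bdPt hΨ y = Φ (inclB g
      (((bBase g).restrictDiffeomorph (RegularSublevel.boundaryData hΨ) e).symm y)) := by
  conv_lhs => rw [← ((bBase g).restrictDiffeomorph (RegularSublevel.boundaryData hΨ) e).apply_symm_apply y]
  exact bdPt_restrictDiffeomorph g hΨ e Φ he _

variable (hw : ∀ z, ∃ r : ℝ, 0 < r ∧ w g (Φ z) = (r : ℂ) * w g z)

include he hw in
/-- `w(ι y) = r · w(ι_B (∂e⁻¹ y))` with `r > 0`. [folklore] -/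
theorem exists_w_bdPt_eq (y : (RegularSublevel.boundaryData hΨ).carrier) :
    ∃ r : ℝ, 0 < r ∧ w g (bdPt hΨ y) = (r : ℂ) * w g (inclB g
      (((bBase g).restrictDiffeomorph (RegularSublevel.boundaryData hΨ) e).symm y)) := by
  rw [bdPt_eq_apply_symm g hΨ e Φ he y]
  exact hw _

include he hw in
/-- **The binding of `(∂e)_* ob_Kas` is `{w ∘ ι = 0}`.** [folklore] -/
theorem mem_binding_map_iff (y : (RegularSublevel.boundaryData hΨ).carrier) :
    y ∈ (flatOB g hΨ e).binding ↔
      w g (bdPt hΨ y) = 0 := by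
  rw [OpenBook.mem_map_binding_iff, mem_binding_boundaryOpenBook_iff]
  obtain ⟨r, hr, hrw⟩ := exists_w_bdPt_eq g hΨ e Φ he hw y
  rw [hrw, mul_eq_zero]
  have : (r : ℂ) ≠ 0 := Complex.ofReal_ne_zero.2 hr.ne'
  simp only [this, false_or]
  rfl

include he hw in
/-- **Off the binding, `(∂e)_* ob_Kas` fibres by the phase of `w ∘ ι`.** [folklore] -/
theorem coe_proj_map {y : (RegularSublevel.boundaryData hΨ).carrier} (hy : w g (bdPt hΨ y) ≠ 0) :
    (((flatOB g hΨ e).proj y :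
          Metric.sphere (0 : E2) 1) : E2) =
      ‖w g (bdPt hΨ y)‖⁻¹ • vec2 (w g (bdPt hΨ y)) := by
  obtain ⟨r, hr, hrw⟩ := exists_w_bdPt_eq g hΨ e Φ he hw y
  have hw0 : w g (inclB g
      (((bBase g).restrictDiffeomorph (RegularSublevel.boundaryData hΨ) e).symm y)) ≠ 0 := by
    intro h0; apply hy; rw [hrw, h0, mul_zero]
  rw [OpenBook.map_proj, comp_apply, proj_boundaryOpenBook g _ hw0]
  change ‖w g (inclB g _)‖⁻¹ • vec2 (w g (inclB g _)) = _
  rw [hrw, norm_mul, Complex.norm_real, Real.norm_eq_abs, abs_of_pos hr, vec2_ofReal_mul,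
    smul_smul]
  congr 1
  field_simp

/-- **`w ∘ ι` is differentiable along `∂X_Ψ` with derivative `dw ∘ L_y`.** [folklore] -/
theorem hasMFDerivAt_w_bdPt (y : (RegularSublevel.boundaryData hΨ).carrier) :
    HasMFDerivAt (𝓡 3) 𝓘(ℝ, ℂ) (fun z => w g (bdPt hΨ z)) y
      (((fderiv ℝ (w g) (bdPt hΨ y)).comp (bdDeriv hΨ y) : E3 →L[ℝ] ℂ)) := by
  have h1 : HasMFDerivAt (𝓡 4) 𝓘(ℝ, ℂ) (w g) (bdPt hΨ y) (fderiv ℝ (w g) (bdPt hΨ y)) :=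
    (((contDiff_w g).differentiable (by simp)) _).hasFDerivAt.hasMFDerivAt
  have h2 : HasMFDerivAt (𝓡∂ 4) (𝓡 4) (RegularSublevel.incl hΨ) y.1
      (inclDeriv hΨ y.1 : E4 →L[ℝ] E4) := by
    rw [coe_inclDeriv]
    exact ((contMDiff_incl_four hΨ y.1).mdifferentiableAt (by simp)).hasMFDerivAt
  have h3 : HasMFDerivAt (𝓡 3) (𝓡∂ 4) (RegularSublevel.boundaryData hΨ).incl y
      (mfderiv (𝓡 3) (𝓡∂ 4) (RegularSublevel.boundaryData hΨ).incl y) :=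
    (((RegularSublevel.boundaryData hΨ).isSmoothEmbedding.contMDiff y).mdifferentiableAt
      (by simp)).hasMFDerivAt
  exact (h1.comp y (h2.comp y h3) : _)

/-! ### §6 The lifted Reeb field and its five properties -/

variable (R : E4 → E4)
  (hF0 : ∀ z, Ψ z = c → fderiv ℝ Ψ z (R z) = 0)

/-- **The lifted field `y ↦ L_y⁻¹ R(ι y)` on `∂X_Ψ`.** [folklore] -/
def reebLift (y : (RegularSublevel.boundaryData hΨ).carrier) : E3 :=
  bdLift hΨ y (R (bdPt hΨ y))

include hF0 in
/-- `L_y (reebLift y) = R (ι y)`. [folklore] -/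
theorem bdDeriv_reebLift (y : (RegularSublevel.boundaryData hΨ).carrier) :
    bdDeriv hΨ y (reebLift hΨ R y) = R (bdPt hΨ y) :=
  bdDeriv_bdLift hΨ y (hF0 _ (apply_bdPt hΨ y))

include he hw hF0 in
/-- **(R3) `dθ(R) > 0` off the binding** from (F3) `Im(w̄ dw(R)) > 0`: the fibration is the
phase of `w ∘ ι` (`coe_proj_map`, `angularDeriv_of_phase`). [cite: Etnyre2006, Lemma 3.3] -/
theorem angularDeriv_reebLift_pos
    (hF3 : ∀ z, Ψ z = c → w g z ≠ 0 → 0 < (conj (w g z) * fderiv ℝ (w g) z (R z)).im)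
    (y : (RegularSublevel.boundaryData hΨ).carrier)
    (hy : y ∉ (flatOB g hΨ e).binding) :
    0 < angularDeriv (flatOB g hΨ e).proj y
        (reebLift hΨ R y) := by
  have hy' : w g (bdPt hΨ y) ≠ 0 := fun h0 => hy ((mem_binding_map_iff g hΨ e Φ he hw y).2 h0)
  have hopen : IsOpen {z : (RegularSublevel.boundaryData hΨ).carrier | w g (bdPt hΨ z) ≠ 0} := by
    refine isOpen_ne.preimage ?_
    exact continuous_iff_continuousAt.2 fun z => (hasMFDerivAt_w_bdPt g hΨ z).continuousAt
  have hev : ∀ᶠ z in 𝓝 y, (((flatOB g hΨ e).proj z :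
        Metric.sphere (0 : E2) 1) : E2) = ‖w g (bdPt hΨ z)‖⁻¹ • vec2 (w g (bdPt hΨ z)) := by
    filter_upwards [hopen.mem_nhds hy'] with z hz
    exact coe_proj_map g hΨ e Φ he hw hz
  rw [angularDeriv_of_phase _ (fun z => w g (bdPt hΨ z)) y (hasMFDerivAt_w_bdPt g hΨ y) hy' hev]
  change 0 < (conj (w g (bdPt hΨ y)) *
    fderiv ℝ (w g) (bdPt hΨ y) (bdDeriv hΨ y (reebLift hΨ R y))).im / ‖w g (bdPt hΨ y)‖ ^ 2
  rw [bdDeriv_reebLift hΨ R hF0]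
  exact div_pos (hF3 _ (apply_bdPt hΨ y) hy') (by positivity)

/-! #### The tube of `(∂e)_* ob_Kas`: `w ∘ ι ∘ tube₀ (x, v) = r · w̃(v)` -/

include he hw in
/-- Along the transported tube, `w ∘ ι` is a positive multiple of `w̃(v) = wsc(v) · v`.
[folklore] -/
theorem exists_w_bdPt_tube (i : Fin (flatOB g hΨ e).k)
    (x : Metric.sphere (0 : E2) 1) (v : E2) :
    ∃ r : ℝ, 0 < r ∧ w g (bdPt hΨ ((flatOB g hΨ e).tube i (x, v))) = (r : ℂ) * wTil v := by
  have h1 : (flatOB g hΨ e).tube i (x, v) =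
      (bBase g).restrictDiffeomorph (RegularSublevel.boundaryData hΨ) e (tube g (x, v)) := rfl
  rw [h1, bdPt_restrictDiffeomorph g hΨ e Φ he]
  obtain ⟨r, hr, h⟩ := hw (inclB g (tube g (x, v)))
  refine ⟨r, hr, ?_⟩
  rw [h, w_tube]

include he hw in
/-- On the transported cores, `w ∘ ι = 0`. [folklore] -/
theorem w_bdPt_tube_core (i : Fin (flatOB g hΨ e).k)
    (x : Metric.sphere (0 : E2) 1) :
    w g (bdPt hΨ ((flatOB g hΨ e).tube i (x, 0))) = 0 := by
  obtain ⟨r, -, hr⟩ := exists_w_bdPt_tube g hΨ e Φ he hw i x 0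
  rw [hr, (wTil_eq_zero_iff _).2 rfl, mul_zero]

/-- The differential of `w ∘ ι ∘ tube₀`, a `HasMFDerivAt` statement. [folklore] -/
theorem hasMFDerivAt_w_bdPt_tube (i : Fin (flatOB g hΨ e).k) (q : (Metric.sphere (0 : E2) 1) × E2) :
    HasMFDerivAt ((𝓡 1).prod 𝓘(ℝ, E2)) 𝓘(ℝ, ℂ)
      (fun q' => w g (bdPt hΨ ((flatOB g hΨ e).tube i q'))) q
      ((((fderiv ℝ (w g) (bdPt hΨ ((flatOB g hΨ e).tube i q))).comp
        (bdDeriv hΨ ((flatOB g hΨ e).tube i q)) : E3 →L[ℝ] ℂ).comp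
        (mfderiv ((𝓡 1).prod 𝓘(ℝ, E2)) (𝓡 3) ((flatOB g hΨ e).tube i) q))) := by
  have ht : HasMFDerivAt ((𝓡 1).prod 𝓘(ℝ, E2)) (𝓡 3) ((flatOB g hΨ e).tube i) q
      (mfderiv ((𝓡 1).prod 𝓘(ℝ, E2)) (𝓡 3) ((flatOB g hΨ e).tube i) q) :=
    ((((flatOB g hΨ e).isSmoothEmbedding_tube i).contMDiff q).mdifferentiableAt (by simp)).hasMFDerivAt
  exact (hasMFDerivAt_w_bdPt g hΨ ((flatOB g hΨ e).tube i q)).comp q ht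

include he hw hF0 in
/-- **(R4) `R` is tangent to the binding**: from (F4) — where `w = 0`, `dw(R) = 0` and
`ker dΨ ∩ ker dw ⊆ ℝ R` — the binding tangent `∂_x tube₀`, which lies in `ker dΨ ∩ ker dw`
(`w ∘ ι ∘ tube₀(·, 0) = 0`), is a multiple of the lifted field. [cite: Etnyre2006, Lemma 3.3] -/
theorem coreTangent_eq_smul_reebLift
    (hF4 : ∀ z, Ψ z = c → w g z = 0 → ∀ v, fderiv ℝ Ψ z v = 0 → fderiv ℝ (w g) z v = 0 →
      ∃ t : ℝ, v = t • R z)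
    (i : Fin (flatOB g hΨ e).k) (x : Metric.sphere (0 : E2) 1) :
    ∃ t : ℝ, (flatOB g hΨ e).coreTangent i x =
      t • reebLift hΨ R ((flatOB g hΨ e).tube i (x, 0)) := by
  -- `dw (L (∂_x tube₀)) = 0`: differentiate `x ↦ w (ι (tube₀ (x, 0))) = 0`
  have hcurve : HasMFDerivAt (𝓡 1) ((𝓡 1).prod 𝓘(ℝ, E2))
      (fun x' : Metric.sphere (0 : E2) 1 => (x', (0 : E2))) x
      ((ContinuousLinearMap.id ℝ E1).prod (0 : E1 →L[ℝ] E2)) :=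
    (hasMFDerivAt_id x).prodMk (hasMFDerivAt_const _ _)
  have hcomp := (hasMFDerivAt_w_bdPt_tube g hΨ e i (x, 0)).comp x hcurve
  have hconst : ((fun q' => w g (bdPt hΨ ((flatOB g hΨ e).tube i q'))) ∘
      fun x' : Metric.sphere (0 : E2) 1 => (x', (0 : E2))) = fun _ => (0 : ℂ) := by
    funext x'
    exact w_bdPt_tube_core g hΨ e Φ he hw i x'
  have hzero : HasMFDerivAt (𝓡 1) 𝓘(ℝ, ℂ)
      ((fun q' => w g (bdPt hΨ ((flatOB g hΨ e).tube i q'))) ∘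
        fun x' : Metric.sphere (0 : E2) 1 => (x', (0 : E2))) x (0 : E1 →L[ℝ] ℂ) := by
    rw [hconst]
    exact hasMFDerivAt_const _ _
  have huniq := hcomp.mfderiv.symm.trans hzero.mfderiv
  have hdw : fderiv ℝ (w g) (bdPt hΨ ((flatOB g hΨ e).tube i (x, 0)))
      (bdDeriv hΨ ((flatOB g hΨ e).tube i (x, 0)) ((flatOB g hΨ e).coreTangent i x)) = 0 := by
    have := DFunLike.congr_fun huniq (EuclideanSpace.single (0 : Fin 1) (1 : ℝ))
    exact this
  obtain ⟨t, ht⟩ := hF4 _ (apply_bdPt hΨ _) (w_bdPt_tube_core g hΨ e Φ he hw i x) _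
    (fderiv_apply_bdDeriv hΨ _ _) hdw
  refine ⟨t, bdDeriv_injective hΨ ((flatOB g hΨ e).tube i (x, 0)) ?_⟩
  rw [ht, map_smul, bdDeriv_reebLift hΨ R hF0]

variable [CompactSpace (RegularSublevel hΨ)] (S : SteinStructure (RegularSublevel hΨ))
  (hSJ : S.J = sublevelJ hΨ stdComplexStructure) (hSφ : S.φ = sublevelPhi hΨ)

include hF0 hSJ hSφ in
/-- **(R1) `β_S(R) > 0`** from (F1) `-dΨ(J₀ R) > 0`. [cite: Etnyre2006, Lemma 3.3] -/
theorem boundaryContactForm_reebLift_pos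
    (hF1 : ∀ z, Ψ z = c → 0 < -(fderiv ℝ Ψ z (stdComplexStructure (R z))))
    (y : (RegularSublevel.boundaryData hΨ).carrier) :
    0 < S.boundaryContactForm (RegularSublevel.boundaryData hΨ) y ![reebLift hΨ R y] := by
  rw [boundaryContactForm_flat hΨ S hSJ hSφ, bdDeriv_reebLift hΨ R hF0]
  exact hF1 _ (apply_bdPt hΨ y)

include hF0 hSJ hSφ in
/-- **(R2) `ι_R dβ_S = 0`** from (F2) `dd^ℂΨ(R, ker dΨ) = 0`. [cite: Etnyre2006, Lemma 3.3] -/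
theorem mextDeriv_boundaryContactForm_reebLift
    (hF2 : ∀ z, Ψ z = c → ∀ v, fderiv ℝ Ψ z v = 0 →
      extDeriv (dComplexFlat stdComplexStructure Ψ) z ![R z, v] = 0)
    (y : (RegularSublevel.boundaryData hΨ).carrier) (u : E3) :
    mextDeriv (S.boundaryContactForm (RegularSublevel.boundaryData hΨ)) y ![reebLift hΨ R y, u] = 0 := by
  rw [mextDeriv_boundaryContactForm_flat hΨ S hSJ hSφ, bdDeriv_reebLift hΨ R hF0,
    hF2 _ (apply_bdPt hΨ y) _ (fderiv_apply_bdDeriv hΨ y u), neg_zero]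


/-! #### (R5) The meridional frame is `dβ_S`-positive -/

omit [CompactSpace (RegularSublevel hΨ)] in
include he hw in
/-- `dw (L (∂_x tube₀)) = 0` at a core point (differentiate `x ↦ w(ι(tube₀(x, 0))) = 0`).
[folklore] -/
theorem fderiv_w_bdDeriv_coreTangent (i : Fin (flatOB g hΨ e).k) (x : Metric.sphere (0 : E2) 1) :
    fderiv ℝ (w g) (bdPt hΨ ((flatOB g hΨ e).tube i (x, 0)))
      (bdDeriv hΨ ((flatOB g hΨ e).tube i (x, 0)) ((flatOB g hΨ e).coreTangent i x)) = 0 := by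
  have hcurve : HasMFDerivAt (𝓡 1) ((𝓡 1).prod 𝓘(ℝ, E2))
      (fun x' : Metric.sphere (0 : E2) 1 => (x', (0 : E2))) x
      ((ContinuousLinearMap.id ℝ E1).prod (0 : E1 →L[ℝ] E2)) :=
    (hasMFDerivAt_id x).prodMk (hasMFDerivAt_const _ _)
  have hcomp := (hasMFDerivAt_w_bdPt_tube g hΨ e i (x, 0)).comp x hcurve
  have hconst : ((fun q' => w g (bdPt hΨ ((flatOB g hΨ e).tube i q'))) ∘
      fun x' : Metric.sphere (0 : E2) 1 => (x', (0 : E2))) = fun _ => (0 : ℂ) := by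
    funext x'
    exact w_bdPt_tube_core g hΨ e Φ he hw i x'
  have hzero : HasMFDerivAt (𝓡 1) 𝓘(ℝ, ℂ)
      ((fun q' => w g (bdPt hΨ ((flatOB g hΨ e).tube i q'))) ∘
        fun x' : Metric.sphere (0 : E2) 1 => (x', (0 : E2))) x (0 : E1 →L[ℝ] ℂ) := by
    rw [hconst]
    exact hasMFDerivAt_const _ _
  have huniq := hcomp.mfderiv.symm.trans hzero.mfderiv
  exact DFunLike.congr_fun huniq (EuclideanSpace.single (0 : Fin 1) (1 : ℝ))

omit [CompactSpace (RegularSublevel hΨ)] in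
/-- **The flat differential of `v ↦ w(ι(tube₀(x, v)))` at a point `v`**, a `HasFDerivAt`
statement on `ℝ²`. [folklore] -/
theorem hasFDerivAt_w_bdPt_tube_disc (i : Fin (flatOB g hΨ e).k) (x : Metric.sphere (0 : E2) 1)
    (v₀ : E2) :
    HasFDerivAt (fun v : E2 => w g (bdPt hΨ ((flatOB g hΨ e).tube i (x, v))))
      ((((fderiv ℝ (w g) (bdPt hΨ ((flatOB g hΨ e).tube i (x, v₀)))).comp
          (bdDeriv hΨ ((flatOB g hΨ e).tube i (x, v₀))) : E3 →L[ℝ] ℂ).comp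
        ((show (E1 × E2) →L[ℝ] E3 from
          mfderiv ((𝓡 1).prod 𝓘(ℝ, E2)) (𝓡 3) ((flatOB g hΨ e).tube i) (x, v₀)).comp
          ((0 : E2 →L[ℝ] E1).prod (ContinuousLinearMap.id ℝ E2))))) v₀ := by
  have hcurve : HasMFDerivAt 𝓘(ℝ, E2) ((𝓡 1).prod 𝓘(ℝ, E2))
      (fun v : E2 => (x, v)) v₀ ((0 : E2 →L[ℝ] E1).prod (ContinuousLinearMap.id ℝ E2)) :=
    (hasMFDerivAt_const _ _).prodMk (hasMFDerivAt_id v₀)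
  have hcomp := (hasMFDerivAt_w_bdPt_tube g hΨ e i (x, v₀)).comp v₀ hcurve
  exact hcomp.hasFDerivAt

omit [CompactSpace (RegularSublevel hΨ)] in
include he hw in
/-- **The direction of `dw ∘ L` on the meridional frame.**  For a direction `d ∈ ℝ²`, the
function `t ↦ w(ι(tube₀(x, t d)))` is a non-negative real multiple of `toC d` for `t > 0`
(`w ∘ ι ∘ tube₀ (x, v) = r w̃(v)`, `w̃(v) = wsc(v) · v`), hence so is its derivative
(`fderiv_apply_direction_of_eventually`). [folklore] -/
theorem direction_fderiv_w_tube (i : Fin (flatOB g hΨ e).k) (x : Metric.sphere (0 : E2) 1)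
    (d : E2) :
    ‖toC d‖ • fderiv ℝ (fun v : E2 => w g (bdPt hΨ ((flatOB g hΨ e).tube i (x, v)))) 0 d =
      ‖fderiv ℝ (fun v : E2 => w g (bdPt hΨ ((flatOB g hΨ e).tube i (x, v)))) 0 d‖ • toC d := by
  refine fderiv_apply_direction_of_eventually
    (hasFDerivAt_w_bdPt_tube_disc g hΨ e i x 0).differentiableAt.hasFDerivAt
    (w_bdPt_tube_core g hΨ e Φ he hw i x) ?_
  filter_upwards [self_mem_nhdsWithin] with t ht
  have ht0 : (0 : ℝ) < t := ht
  obtain ⟨r, hr, hrw⟩ := exists_w_bdPt_tube g hΨ e Φ he hw i x (0 + t • d)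
  rw [hrw, zero_add, wTil, toC_smul]
  have hκ : 0 < r * wsc (t • d) * t := by
    have := wsc_pos (t • d); positivity
  have e1 : (r : ℂ) * ((wsc (t • d) : ℂ) * ((t : ℂ) * toC d)) = ((r * wsc (t • d) * t : ℝ) : ℂ) * toC d := by
    push_cast; ring
  rw [e1, norm_mul, Complex.norm_real, Real.norm_eq_abs, abs_of_pos hκ, Complex.real_smul,
    Complex.real_smul]
  push_cast
  ring

omit [CompactSpace (RegularSublevel hΨ)] in
include he hw in
/-- **`dw(L e₂) = i · dw(L e₁)` with `dw(L e₁)` a non-negative real** on the meridional frame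
`(e₁, e₂)` of the transported tube. [folklore] -/
theorem fderiv_w_bdDeriv_discFrame (i : Fin (flatOB g hΨ e).k) (x : Metric.sphere (0 : E2) 1) :
    ∃ a : ℝ, 0 ≤ a ∧
      fderiv ℝ (w g) (bdPt hΨ ((flatOB g hΨ e).tube i (x, 0)))
        (bdDeriv hΨ ((flatOB g hΨ e).tube i (x, 0)) ((flatOB g hΨ e).discFrame i x 0)) = (a : ℂ) ∧
      fderiv ℝ (w g) (bdPt hΨ ((flatOB g hΨ e).tube i (x, 0)))
        (bdDeriv hΨ ((flatOB g hΨ e).tube i (x, 0)) ((flatOB g hΨ e).discFrame i x 1)) =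
          (a : ℂ) * I := by
  set T : E2 →L[ℝ] ℂ := fderiv ℝ (fun v : E2 => w g (bdPt hΨ ((flatOB g hΨ e).tube i (x, v)))) 0
    with hT
  -- `T eⱼ = dw (L (discFrame j))`
  have hTj : ∀ j : Fin 2, T (EuclideanSpace.single j 1) =
      fderiv ℝ (w g) (bdPt hΨ ((flatOB g hΨ e).tube i (x, 0)))
        (bdDeriv hΨ ((flatOB g hΨ e).tube i (x, 0)) ((flatOB g hΨ e).discFrame i x j)) := by
    intro j
    rw [hT, (hasFDerivAt_w_bdPt_tube_disc g hΨ e i x 0).fderiv]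
    rfl
  have h0 := direction_fderiv_w_tube g hΨ e Φ he hw i x (EuclideanSpace.single 0 1)
  have h1 := direction_fderiv_w_tube g hΨ e Φ he hw i x (EuclideanSpace.single 1 1)
  have h01 := direction_fderiv_w_tube g hΨ e Φ he hw i x
    (EuclideanSpace.single 0 1 + EuclideanSpace.single 1 1)
  rw [← hT] at h0 h1 h01
  have hc0 : toC (EuclideanSpace.single (0 : Fin 2) (1 : ℝ)) = 1 := Complex.ext (by simp [toC]) (by simp [toC])
  have hc1 : toC (EuclideanSpace.single (1 : Fin 2) (1 : ℝ)) = I := Complex.ext (by simp [toC]) (by simp [toC])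
  have hc01 : toC (EuclideanSpace.single (0 : Fin 2) (1 : ℝ) + EuclideanSpace.single 1 1) = 1 + I :=
    Complex.ext (by simp [toC]) (by simp [toC])
  rw [hc0, norm_one, one_smul] at h0
  rw [hc1, Complex.norm_I, one_smul] at h1
  rw [hc01, map_add] at h01
  set a : ℝ := ‖T (EuclideanSpace.single 0 1)‖ with ha
  set b : ℝ := ‖T (EuclideanSpace.single 1 1)‖ with hb
  -- compare real and imaginary parts of `h01`
  have hab : a = b := by
    have hre := congrArg Complex.re h01
    have him := congrArg Complex.im h01
    rw [h0, h1] at hre him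
    simp [Complex.real_smul] at hre him
    have hs : ‖(1 : ℂ) + I‖ ≠ 0 := norm_ne_zero_iff.2 (by
      intro h; have := congrArg Complex.re h; simp at this)
    have : (a : ℝ) = b := by
      have e1 : ‖(1 : ℂ) + I‖ * a = ‖(a : ℂ) + (b : ℂ) * I‖ := by linarith
      have e2 : ‖(1 : ℂ) + I‖ * b = ‖(a : ℂ) + (b : ℂ) * I‖ := by linarith
      exact mul_left_cancel₀ hs (e1.trans e2.symm)
    exact this
  refine ⟨a, norm_nonneg _, ?_, ?_⟩
  · rw [← hTj 0, h0, Complex.real_smul, mul_one]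
  · rw [← hTj 1, h1, ← hab, Complex.real_smul]

/-- The differential of a binding tube is onto `ℝ³` (injective between spaces of dimension `3`).
[folklore] -/
theorem surjective_mfderiv_tube {M : Type*} [TopologicalSpace M] [ChartedSpace E3 M]
    [IsManifold (𝓡 3) ∞ M] (ob : OpenBook M) (i : Fin ob.k)
    (q : (Metric.sphere (0 : E2) 1) × E2) :
    Surjective (show (E1 × E2) →L[ℝ] E3 from mfderiv ((𝓡 1).prod 𝓘(ℝ, E2)) (𝓡 3) (ob.tube i) q) := by
  set Mq : (E1 × E2) →L[ℝ] E3 :=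
    (show (E1 × E2) →L[ℝ] E3 from mfderiv ((𝓡 1).prod 𝓘(ℝ, E2)) (𝓡 3) (ob.tube i) q) with hMq
  have hinj : Injective (Mq : (E1 × E2) →ₗ[ℝ] E3) := ob.injective_mfderiv_tube i q
  have hdim : finrank ℝ (E1 × E2) = finrank ℝ E3 := by
    rw [Module.finrank_prod, finrank_euclideanSpace_fin, finrank_euclideanSpace_fin,
      finrank_euclideanSpace_fin]
  exact (LinearMap.injective_iff_surjective_of_finrank_eq_finrank hdim).1 hinj

omit [CompactSpace (RegularSublevel hΨ)] in
include he hw in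
/-- **`dw(L e₁) ≠ 0` on the meridional frame**: otherwise `dw ∘ L_{y₀}` would vanish on the
whole frame `(∂_x tube₀, e₁, e₂)`, i.e. on `ker dΨ`, and (F4) would squeeze the `3`-dimensional
`ker dΨ` into the line `ℝ R`. [folklore] -/
theorem fderiv_w_bdDeriv_discFrame_ne_zero
    (hF4 : ∀ z, Ψ z = c → w g z = 0 → ∀ v, fderiv ℝ Ψ z v = 0 → fderiv ℝ (w g) z v = 0 →
      ∃ t : ℝ, v = t • R z)
    (i : Fin (flatOB g hΨ e).k) (x : Metric.sphere (0 : E2) 1) :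
    fderiv ℝ (w g) (bdPt hΨ ((flatOB g hΨ e).tube i (x, 0)))
      (bdDeriv hΨ ((flatOB g hΨ e).tube i (x, 0)) ((flatOB g hΨ e).discFrame i x 0)) ≠ 0 := by
  intro h0
  obtain ⟨a, -, ha0, ha1⟩ := fderiv_w_bdDeriv_discFrame g hΨ e Φ he hw i x
  set y₀ := (flatOB g hΨ e).tube i (x, 0) with hy₀
  set Dw : E4 →L[ℝ] ℂ := fderiv ℝ (w g) (bdPt hΨ y₀) with hDw
  have ha : (a : ℂ) = 0 := ha0.symm.trans h0
  have h1 : Dw (bdDeriv hΨ y₀ ((flatOB g hΨ e).discFrame i x 1)) = 0 := by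
    rw [hDw, ha1, ha, zero_mul]
  have hb : Dw (bdDeriv hΨ y₀ ((flatOB g hΨ e).coreTangent i x)) = 0 :=
    fderiv_w_bdDeriv_coreTangent g hΨ e Φ he hw i x
  -- `Dw ∘ L = 0` on all of `ℝ³`
  have hall : ∀ u : E3, Dw (bdDeriv hΨ y₀ u) = 0 := by
    intro u
    set Mq : (E1 × E2) →L[ℝ] E3 := (show (E1 × E2) →L[ℝ] E3 from
      mfderiv ((𝓡 1).prod 𝓘(ℝ, E2)) (𝓡 3) ((flatOB g hΨ e).tube i) (x, 0)) with hMq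
    obtain ⟨p, rfl⟩ : ∃ p : E1 × E2, Mq p = u := surjective_mfderiv_tube (flatOB g hΨ e) i (x, 0) u
    have hp : p = (p.1 0) • ((EuclideanSpace.single (0 : Fin 1) (1 : ℝ), (0 : E2)) : E1 × E2) +
        (p.2 0) • (((0 : E1), EuclideanSpace.single (0 : Fin 2) (1 : ℝ)) : E1 × E2) +
        (p.2 1) • (((0 : E1), EuclideanSpace.single (1 : Fin 2) (1 : ℝ)) : E1 × E2) := by
      refine Prod.ext ?_ ?_
      · ext j; fin_cases j; simp
      · ext j; fin_cases j <;> simp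
    have hb' : Dw (bdDeriv hΨ y₀ (Mq ((EuclideanSpace.single (0 : Fin 1) (1 : ℝ), (0 : E2)) : E1 × E2))) = 0 := hb
    have h0' : Dw (bdDeriv hΨ y₀ (Mq (((0 : E1), EuclideanSpace.single (0 : Fin 2) (1 : ℝ)) : E1 × E2))) = 0 := by
      rw [hDw]; exact h0
    have h1' : Dw (bdDeriv hΨ y₀ (Mq (((0 : E1), EuclideanSpace.single (1 : Fin 2) (1 : ℝ)) : E1 × E2))) = 0 := h1
    rw [hp]
    simp only [map_add, map_smul, hb', h0', h1', smul_zero, add_zero]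
  -- hence `ker dΨ ⊆ ℝ R`, contradicting `dim ker dΨ = 3`
  have hsub : LinearMap.ker ((fderiv ℝ Ψ (bdPt hΨ y₀) : E4 →L[ℝ] ℝ) : E4 →ₗ[ℝ] ℝ) ≤
      Submodule.span ℝ {R (bdPt hΨ y₀)} := by
    intro V hV
    obtain ⟨u, rfl⟩ := exists_bdDeriv_eq hΨ y₀ (V := V) hV
    obtain ⟨t, ht⟩ := hF4 _ (apply_bdPt hΨ y₀) (w_bdPt_tube_core g hΨ e Φ he hw i x) _
      (fderiv_apply_bdDeriv hΨ y₀ u) (hall u)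
    rw [ht]
    exact Submodule.smul_mem _ _ (Submodule.subset_span rfl)
  have h3 := finrank_ker_fderiv_bdPt hΨ y₀
  have hle := Submodule.finrank_mono hsub
  have h1' : finrank ℝ (Submodule.span ℝ ({R (bdPt hΨ y₀)} : Set E4)) ≤ 1 :=
    (finrank_span_le_card _).trans (by simp)
  omega

omit [CompactSpace (RegularSublevel hΨ)] in
include he hw in
/-- **The meridional frame of the transported tube is positively oriented by `dw`**:
`Im(conj(dw L e₁) · dw L e₂) > 0`. [folklore] -/
theorem im_conj_fderiv_w_discFrame_pos
    (hF4 : ∀ z, Ψ z = c → w g z = 0 → ∀ v, fderiv ℝ Ψ z v = 0 → fderiv ℝ (w g) z v = 0 →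
      ∃ t : ℝ, v = t • R z)
    (i : Fin (flatOB g hΨ e).k) (x : Metric.sphere (0 : E2) 1) :
    0 < (conj (fderiv ℝ (w g) (bdPt hΨ ((flatOB g hΨ e).tube i (x, 0)))
        (bdDeriv hΨ ((flatOB g hΨ e).tube i (x, 0)) ((flatOB g hΨ e).discFrame i x 0))) *
      fderiv ℝ (w g) (bdPt hΨ ((flatOB g hΨ e).tube i (x, 0)))
        (bdDeriv hΨ ((flatOB g hΨ e).tube i (x, 0)) ((flatOB g hΨ e).discFrame i x 1))).im := by
  obtain ⟨a, ha, ha0, ha1⟩ := fderiv_w_bdDeriv_discFrame g hΨ e Φ he hw i x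
  have hne := fderiv_w_bdDeriv_discFrame_ne_zero g hΨ e Φ he hw R hF4 i x
  rw [ha0] at hne ⊢
  rw [ha1]
  have ha' : a ≠ 0 := fun h => hne (by rw [h]; simp)
  simp only [Complex.mul_im, Complex.conj_re, Complex.conj_im, Complex.ofReal_re,
    Complex.ofReal_im, Complex.mul_re, Complex.I_re, Complex.I_im, mul_zero, mul_one, sub_zero,
    add_zero, neg_zero]
  positivity

include he hw hSJ hSφ in
/-- **(R5) `dβ_S(e₁, e₂) > 0` on the meridional frame** from (F5). [cite: Etnyre2006, Lemma 3.3] -/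
theorem mextDeriv_boundaryContactForm_discFrame_pos
    (hF4 : ∀ z, Ψ z = c → w g z = 0 → ∀ v, fderiv ℝ Ψ z v = 0 → fderiv ℝ (w g) z v = 0 →
      ∃ t : ℝ, v = t • R z)
    (hF5 : ∀ z, Ψ z = c → w g z = 0 → ∀ e₁ e₂ : E4, fderiv ℝ Ψ z e₁ = 0 → fderiv ℝ Ψ z e₂ = 0 →
      0 < (conj (fderiv ℝ (w g) z e₁) * fderiv ℝ (w g) z e₂).im →
      0 < -(extDeriv (dComplexFlat stdComplexStructure Ψ) z ![e₁, e₂]))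
    (i : Fin (flatOB g hΨ e).k) (x : Metric.sphere (0 : E2) 1) :
    0 < mextDeriv (S.boundaryContactForm (RegularSublevel.boundaryData hΨ))
      ((flatOB g hΨ e).tube i (x, 0)) ![(flatOB g hΨ e).discFrame i x 0, (flatOB g hΨ e).discFrame i x 1] := by
  rw [mextDeriv_boundaryContactForm_flat hΨ S hSJ hSφ]
  exact hF5 _ (apply_bdPt hΨ _) (w_bdPt_tube_core g hΨ e Φ he hw i x) _ _
    (fderiv_apply_bdDeriv hΨ _ _) (fderiv_apply_bdDeriv hΨ _ _)
    (im_conj_fderiv_w_discFrame_pos g hΨ e Φ he hw R hF4 i x)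

/-! ### §7 The orientation clause -/

variable (hle : Φ '' (LefschetzBase.rho g ⁻¹' Iic (1 / 4)) = Ψ ⁻¹' Iic c)
  (heq : Φ '' (LefschetzBase.rho g ⁻¹' {1 / 4}) = Ψ ⁻¹' {c})
  (hdet : ∀ z, 0 < LinearMap.det (fderiv ℝ Φ z : E4 →ₗ[ℝ] E4))

omit [CompactSpace (RegularSublevel hΨ)] in
/-- `Φ` is `C^∞` as a map of `ℝ⁴`. [folklore] -/
theorem contDiff_diffeo : ContDiff ℝ ∞ (Φ : E4 → E4) := by
  rw [← contMDiff_iff_contDiff]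
  exact Φ.contMDiff

omit [CompactSpace (RegularSublevel hΨ)] in
include hle heq in
/-- `Ψ (Φ z) ≤ c ↔ rho z ≤ 1/4` and `Ψ (Φ z) = c ↔ rho z = 1/4`. [folklore] -/
theorem apply_diffeo_le_iff (z : E4) : (Ψ (Φ z) ≤ c ↔ LefschetzBase.rho g z ≤ 1 / 4) ∧ (LefschetzBase.rho g z = 1 / 4 → Ψ (Φ z) = c) := by
  constructor
  · constructor
    · intro hz
      have : Φ z ∈ Φ '' (LefschetzBase.rho g ⁻¹' Iic (1 / 4)) := by rw [hle]; exact hz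
      obtain ⟨z', hz', hzz⟩ := this
      rw [← Φ.injective hzz]; exact hz'
    · intro hz
      have : Φ z ∈ Ψ ⁻¹' Iic c := by rw [← hle]; exact ⟨z, hz, rfl⟩
      exact this
  · intro hz
    have : Φ z ∈ Ψ ⁻¹' {c} := by rw [← heq]; exact ⟨z, hz, rfl⟩
    exact this

omit [CompactSpace (RegularSublevel hΨ)] in
/-- `d rho(∇rho) = ‖∇rho‖²`, and `∇rho ≠ 0` on the regular level. [folklore] -/
theorem fderiv_rho_gradient (q : E4) :
    fderiv ℝ (LefschetzBase.rho g) q (gradient (LefschetzBase.rho g) q) = ‖gradient (LefschetzBase.rho g) q‖ ^ 2 := by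
  rw [gradient, ← InnerProductSpace.toDual_symm_apply, real_inner_self_eq_norm_sq]

omit [CompactSpace (RegularSublevel hΨ)] in
include he hle heq hdet in
/-- **`DΦ(∇rho)` points out of `X_Ψ`: `dΨ_{Φ q}(DΦ_q ∇rho(q)) > 0` on `{rho = 1/4}`.**  Sign:
`Φ` maps `{rho ≤ 1/4}` onto `{Ψ ≤ c}`, so `t ↦ Ψ(Φ(q + t ∇rho))` exceeds `c` for small `t > 0`;
non-vanishing: `dΨ ∘ DΦ` kills `T_q{rho = 1/4}` (levels are preserved), `DΦ` is onto and
`dΨ ≠ 0`. [folklore] -/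
theorem fderiv_apply_diffeo_gradient_pos {q : E4} (hq : LefschetzBase.rho g q = 1 / 4) :
    0 < fderiv ℝ Ψ (Φ q) (fderiv ℝ Φ q (gradient (LefschetzBase.rho g) q)) := by
  set n := gradient (LefschetzBase.rho g) q with hn
  have hΨs : ContDiff ℝ ∞ Ψ := contDiff_of_isRegularLevel hΨ
  have hΦs : ContDiff ℝ ∞ (Φ : E4 → E4) := contDiff_diffeo Φ
  -- the curve and the two composites
  have hline : HasDerivAt (fun t : ℝ => q + t • n) n 0 := by
    simpa using ((hasDerivAt_id (0 : ℝ)).smul_const n).const_add q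
  have hρ : HasDerivAt (fun t : ℝ => LefschetzBase.rho g (q + t • n)) (‖n‖ ^ 2) 0 := by
    have h1 : HasFDerivAt (LefschetzBase.rho g) (fderiv ℝ (LefschetzBase.rho g) q) (q + (0 : ℝ) • n) := by
      simpa using (((LefschetzBase.contDiff_rho g).differentiable (by simp)) q).hasFDerivAt
    have := h1.comp_hasDerivAt (0 : ℝ) hline
    rwa [fderiv_rho_gradient] at this
  set F : ℝ → ℝ := fun t => Ψ (Φ (q + t • n)) with hFdef
  have hf : HasDerivAt F (fderiv ℝ Ψ (Φ q) (fderiv ℝ Φ q n)) 0 := by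
    have h1 : HasFDerivAt (Φ : E4 → E4) (fderiv ℝ Φ q) (q + (0 : ℝ) • n) := by
      simpa using ((hΦs.differentiable (by simp)) q).hasFDerivAt
    have hΦc : HasDerivAt (fun t : ℝ => Φ (q + t • n)) (fderiv ℝ Φ q n) 0 :=
      h1.comp_hasDerivAt (0 : ℝ) hline
    have h2 : HasFDerivAt Ψ (fderiv ℝ Ψ (Φ q)) (Φ (q + (0 : ℝ) • n)) := by
      simpa using ((hΨs.differentiable (by simp)) (Φ q)).hasFDerivAt
    exact h2.comp_hasDerivAt (0 : ℝ) hΦc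
  -- `∇rho ≠ 0` (regular level)
  have hn0 : 0 < ‖n‖ ^ 2 := by
    have hreg : fderiv ℝ (LefschetzBase.rho g) q ≠ 0 := by
      have := fderiv_bdPt_ne_zero (isRegularLevel_rho g) (bPt g q hq)
      exact this
    have : n ≠ 0 := by
      intro h0
      apply hreg
      have : (InnerProductSpace.toDual ℝ E4).symm (fderiv ℝ (LefschetzBase.rho g) q) = 0 := h0
      simpa using this
    positivity
  -- sign: `F t > c = F 0` for small `t > 0`
  have hF0 : F 0 = c := by
    have := (apply_diffeo_le_iff g Φ hle heq q).2 hq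
    simpa [hFdef] using this
  have hpos_ev : ∀ᶠ t in 𝓝[>] (0 : ℝ), 0 ≤ t⁻¹ • (F (0 + t) - F 0) := by
    have hev : ∀ᶠ t in 𝓝[>] (0 : ℝ),
        0 < t⁻¹ • (LefschetzBase.rho g (q + (0 + t) • n) - LefschetzBase.rho g (q + (0 : ℝ) • n)) :=
      hρ.tendsto_slope_zero_right.eventually (lt_mem_nhds hn0)
    filter_upwards [hev, self_mem_nhdsWithin] with t ht ht0
    have ht0' : (0 : ℝ) < t := ht0
    rw [zero_add, zero_smul, add_zero, smul_eq_mul] at ht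
    have hρt : 1 / 4 < LefschetzBase.rho g (q + t • n) := by
      have : 0 < LefschetzBase.rho g (q + t • n) - LefschetzBase.rho g q :=
        (mul_pos_iff_of_pos_left (inv_pos.2 ht0')).1 ht
      linarith
    have hΨt : c < F t := by
      by_contra hle'
      push Not at hle'
      have := ((apply_diffeo_le_iff g Φ hle heq (q + t • n)).1).1 hle'
      linarith
    rw [zero_add, hF0, smul_eq_mul]
    exact mul_nonneg (inv_pos.2 ht0').le (by linarith)
  have hge : 0 ≤ fderiv ℝ Ψ (Φ q) (fderiv ℝ Φ q n) :=
    ge_of_tendsto hf.tendsto_slope_zero_right hpos_ev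
  -- non-vanishing
  have hne : fderiv ℝ Ψ (Φ q) (fderiv ℝ Φ q n) ≠ 0 := by
    intro h0
    -- `dΨ ∘ DΦ` vanishes on `T_q {rho = 1/4}`
    set yB : (bBase g).carrier := bPt g q hq with hyB
    have hconst : ∀ y' : (bBase g).carrier, (Ψ ∘ Φ) (bdPt (isRegularLevel_rho g) y') = c :=
      fun y' => (apply_diffeo_le_iff g Φ hle heq _).2 (rho_inclB g y')
    have hdiff : Differentiable ℝ (Ψ ∘ (Φ : E4 → E4)) :=
      (hΨs.differentiable (by simp)).comp (hΦs.differentiable (by simp))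
    have htan : ∀ u : E3, fderiv ℝ (Ψ ∘ (Φ : E4 → E4)) q
        (bdDeriv (isRegularLevel_rho g) yB u) = 0 :=
      fun u => fderiv_apply_bdDeriv_of_const (isRegularLevel_rho g) hdiff hconst yB u
    have hchain : fderiv ℝ (Ψ ∘ (Φ : E4 → E4)) q = (fderiv ℝ Ψ (Φ q)).comp (fderiv ℝ Φ q) :=
      fderiv_comp q ((hΨs.differentiable (by simp)) _) ((hΦs.differentiable (by simp)) _)
    -- hence on all of `ℝ⁴ = ℝ n ⊕ ker d rho`
    have hall : ∀ v : E4, fderiv ℝ Ψ (Φ q) (fderiv ℝ Φ q v) = 0 := by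
      intro v
      set s : ℝ := fderiv ℝ (LefschetzBase.rho g) q v / ‖n‖ ^ 2 with hs
      have hker : fderiv ℝ (LefschetzBase.rho g) q (v - s • n) = 0 := by
        rw [map_sub, map_smul, fderiv_rho_gradient, hs, smul_eq_mul,
          div_mul_cancel₀ _ hn0.ne', sub_self]
      obtain ⟨u, hu⟩ := exists_bdDeriv_eq (isRegularLevel_rho g) yB (V := v - s • n) hker
      have h1 := htan u
      rw [hu, hchain, ContinuousLinearMap.comp_apply, map_sub, map_smul, map_sub, map_smul,
        h0, smul_zero, sub_zero] at h1
      exact h1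
    -- `DΦ_q` is onto, so `dΨ_{Φ q} = 0`: contradiction with regularity
    have hsurj : Surjective (fderiv ℝ Φ q) :=
      (LinearMap.equivOfDetNeZero (fderiv ℝ Φ q : E4 →ₗ[ℝ] E4) (hdet q).ne').surjective
    have hzero : fderiv ℝ Ψ (Φ q) = 0 := by
      ext v'
      obtain ⟨v, rfl⟩ := hsurj v'
      exact hall v
    have hy : bdPt hΨ ((bBase g).restrictDiffeomorph (RegularSublevel.boundaryData hΨ) e yB) = Φ q :=
      bdPt_restrictDiffeomorph g hΨ e Φ he yB
    have := fderiv_bdPt_ne_zero hΨ ((bBase g).restrictDiffeomorph (RegularSublevel.boundaryData hΨ) e yB)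
    rw [hy] at this
    exact this hzero
  exact lt_of_le_of_ne hge (Ne.symm hne)

omit [CompactSpace (RegularSublevel hΨ)] in
include he in
/-- **Chain rule along the base piece**: `Dι ∘ d(e ∘ incl) = DΦ ∘ ambientC`. [folklore] -/
theorem inclDeriv_mfderiv_jA {ι : Type} [Finite ι] [IsEmpty ι]
    (h : ι → HandleAttachingMap 3 2 (Base g)) (a : ↥(coresComplement h))
    (vv : E4) :
    inclDeriv hΨ (e (a : Base g)) (mfderiv (𝓡∂ 4) (𝓡∂ 4) (flatModelData g hΨ e h).jA a vv) =
      fderiv ℝ Φ ((a : Base g).1) (ambientC h a vv) := by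
  have hval : ContMDiff (𝓡∂ 4) (𝓡∂ 4) ∞ (Subtype.val : ↥(coresComplement h) → Base g) :=
    (Manifold.IsSmoothEmbedding.of_opens (coresComplement h)).contMDiff
  have hvald : MDifferentiableAt (𝓡∂ 4) (𝓡∂ 4) (Subtype.val : ↥(coresComplement h) → Base g) a :=
    (hval a).mdifferentiableAt (by simp)
  have hed : MDifferentiableAt (𝓡∂ 4) (𝓡∂ 4) e (a : Base g) :=
    (e.contMDiff (a : Base g)).mdifferentiableAt (by simp)
  have hinc : MDifferentiableAt (𝓡∂ 4) (𝓡 4) (RegularSublevel.incl hΨ) (e (a : Base g)) :=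
    (contMDiff_incl_four hΨ _).mdifferentiableAt (by simp)
  have hincB : MDifferentiableAt (𝓡∂ 4) (𝓡 4) (RegularSublevel.incl (isRegularLevel_rho g))
      (a : Base g) :=
    (contMDiff_incl_four (isRegularLevel_rho g) _).mdifferentiableAt (by simp)
  have hΦd : MDifferentiableAt (𝓡 4) (𝓡 4) (Φ : E4 → E4)
      (RegularSublevel.incl (isRegularLevel_rho g) (a : Base g)) :=
    (Φ.contMDiff _).mdifferentiableAt (by simp)
  -- `d(e ∘ val) vv = de (d val vv)`
  set W := mfderiv (𝓡∂ 4) (𝓡∂ 4) (Subtype.val : ↥(coresComplement h) → Base g) a vv with hW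
  have c1 : mfderiv (𝓡∂ 4) (𝓡∂ 4) (flatModelData g hΨ e h).jA a vv =
      mfderiv (𝓡∂ 4) (𝓡∂ 4) e (a : Base g) W := by
    have := DFunLike.congr_fun (mfderiv_comp a hed hvald) vv
    exact this
  -- `Dι (de W) = DΦ (Dι_B W)`
  have c2 : inclDeriv hΨ (e (a : Base g)) (mfderiv (𝓡∂ 4) (𝓡∂ 4) e (a : Base g) W) =
      fderiv ℝ Φ ((a : Base g).1) (inclDeriv (isRegularLevel_rho g) (a : Base g) W) := by
    have h1 := mfderiv_comp (a : Base g) hinc hed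
    have h2 := mfderiv_comp (a : Base g) hΦd hincB
    have hfun : RegularSublevel.incl hΨ ∘ e =
        (Φ : E4 → E4) ∘ RegularSublevel.incl (isRegularLevel_rho g) := funext he
    rw [hfun, h2, mfderiv_eq_fderiv] at h1
    have h3 := DFunLike.congr_fun h1 W
    rw [inclDeriv_apply, inclDeriv_apply]
    exact h3.symm
  -- `ambientC vv = Dι_B W`
  have c3 : ambientC h a vv = inclDeriv (isRegularLevel_rho g) (a : Base g) W := by
    have := DFunLike.congr_fun (mfderiv_comp a hincB hvald) vv
    rw [inclDeriv_apply]
    exact this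
  rw [c1, c2, c3]

include he hle heq hdet hSJ hSφ in
/-- **(O) The orientation clause**: `d(D₀.jA)` carries positive boundary frames of `∂ Base g`
(`IsPosBdryFrame`: `det4(∇rho, v) > 0`) to frames which, preceded by the outward vector
`n = Dι⁻¹ DΦ ∇rho` (`dφ(n) > 0`), are positive in the `S.J`-adapted basis `Dι⁻¹(e₀, e₁, e₂, e₃)`:
the determinant is `det DΦ · det4(∇rho, v) > 0`. [folklore] -/
theorem orientation_flatModel {ι : Type} [Finite ι] [IsEmpty ι]
    (h : ι → HandleAttachingMap 3 2 (Base g))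
    (y : (RegularSublevel.boundaryData hΨ).carrier) (a : ↥(coresComplement h))
    (u : Fin 3 → E3) (v : Fin 3 → E4)
    (hya : (RegularSublevel.boundaryData hΨ).incl y = (flatModelData g hΨ e h).jA a)
    (huv : ∀ k, mfderiv (𝓡 3) (𝓡∂ 4) (RegularSublevel.boundaryData hΨ).incl y (u k) =
      mfderiv (𝓡∂ 4) (𝓡∂ 4) (flatModelData g hΨ e h).jA a (v k))
    (hfr : IsPosBdryFrame h a v) :
    ∃ (bJ : Module.Basis (Fin 4) ℝ E4) (n : E4),
      ComplexStructure.IsAdaptedBasis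
        (S.J ((RegularSublevel.boundaryData hΨ).incl y) : E4 →ₗ[ℝ] E4) bJ ∧
      0 < S.dφ ((RegularSublevel.boundaryData hΨ).incl y) n ∧
      0 < bJ.det ![n, mfderiv (𝓡 3) (𝓡∂ 4) (RegularSublevel.boundaryData hΨ).incl y (u 0),
        mfderiv (𝓡 3) (𝓡∂ 4) (RegularSublevel.boundaryData hΨ).incl y (u 1),
        mfderiv (𝓡 3) (𝓡∂ 4) (RegularSublevel.boundaryData hΨ).incl y (u 2)] := by
  set q : E4 := (a : Base g).1 with hq
  have hy1 : y.1 = e (a : Base g) := hya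
  have hbd : bdPt hΨ y = Φ q := by
    unfold bdPt
    rw [hy1, he]
    rfl
  have hρq : LefschetzBase.rho g q = 1 / 4 := by
    have h1 : Ψ (Φ q) = c := by rw [← hbd]; exact apply_bdPt hΨ y
    have : Φ q ∈ Φ '' (LefschetzBase.rho g ⁻¹' {1 / 4}) := by rw [heq]; exact h1
    obtain ⟨q', hq', hqq⟩ := this
    rw [← Φ.injective hqq]; exact hq'
  set D : E4 ≃L[ℝ] E4 := inclDeriv hΨ y.1 with hD
  set n₀ : E4 := fderiv ℝ Φ q (gradient (LefschetzBase.rho g) q) with hn₀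
  refine ⟨(PiLp.basisFun 2 ℝ (Fin 4)).map (D.symm : E4 ≃L[ℝ] E4).toLinearEquiv, D.symm n₀,
    isAdaptedBasis_flat hΨ S hSJ y.1, ?_, ?_⟩
  · -- outward
    have : S.dφ y.1 (D.symm n₀) = fderiv ℝ Ψ (bdPt hΨ y) n₀ := by
      rw [dφ_flat hΨ S hSφ, hD, ContinuousLinearEquiv.apply_symm_apply]
      rfl
    rw [show (RegularSublevel.boundaryData hΨ).incl y = y.1 from rfl, this, hbd]
    exact fderiv_apply_diffeo_gradient_pos g hΨ e Φ he hle heq hdet hρq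
  · -- positive
    have hk : ∀ k, D (mfderiv (𝓡 3) (𝓡∂ 4) (RegularSublevel.boundaryData hΨ).incl y (u k)) =
        fderiv ℝ Φ q (ambientC h a (v k)) := by
      intro k
      have h1 : D (mfderiv (𝓡 3) (𝓡∂ 4) (RegularSublevel.boundaryData hΨ).incl y (u k)) =
          inclDeriv hΨ (e (a : Base g)) (mfderiv (𝓡∂ 4) (𝓡∂ 4) (flatModelData g hΨ e h).jA a (v k)) := by
        rw [hD, huv k, hy1]
      rw [h1]
      exact inclDeriv_mfderiv_jA g hΨ e Φ he h a (v k)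
    set V : Fin 4 → E4 := ![D.symm n₀, mfderiv (𝓡 3) (𝓡∂ 4) (RegularSublevel.boundaryData hΨ).incl y (u 0),
        mfderiv (𝓡 3) (𝓡∂ 4) (RegularSublevel.boundaryData hΨ).incl y (u 1),
        mfderiv (𝓡 3) (𝓡∂ 4) (RegularSublevel.boundaryData hΨ).incl y (u 2)] with hV
    have e0 : D (V 0) = fderiv ℝ Φ q (gradient (LefschetzBase.rho g) q) := by
      rw [hV]; simp [hn₀]
    have e1 : D (V 1) = fderiv ℝ Φ q (ambientC h a (v 0)) := by
      rw [hV, ← hk 0]; rfl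
    have e2 : D (V 2) = fderiv ℝ Φ q (ambientC h a (v 1)) := by
      rw [hV, ← hk 1]; rfl
    have e3 : D (V 3) = fderiv ℝ Φ q (ambientC h a (v 2)) := by
      rw [hV, ← hk 2]; rfl
    rw [det_map_symm, e0, e1, e2, e3]
    have := det4_linearMap (fderiv ℝ Φ q : E4 →ₗ[ℝ] E4) (gradient (LefschetzBase.rho g) q)
      (ambientC h a (v 0)) (ambientC h a (v 1)) (ambientC h a (v 2))
    rw [show ((fderiv ℝ Φ q : E4 →ₗ[ℝ] E4) : E4 → E4) = fderiv ℝ Φ q from rfl] at this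
    rw [this]
    exact mul_pos (hdet q) hfr

/-! ### §8 Assembly: the conclusion of the named fact for every handle-free family -/

include he hw hle heq hdet hF0 hSJ hSφ in
/-- **PALF ⇒ Stein with supported Kas open book, handle-free case, from a flat Reeb-compatible
Stein model of the base.**  See the module docstring.  (The hypotheses `hle`, `heq`, `hw`,
`hdet`, `hSJ`, `hSφ` are what `LefschetzBaseModelStein.exists_steinStructure_model` /
`LefschetzBase.exists_model_diffeomorph_orient` deliver; (F0)–(F5) are pointwise flat linear
algebra of `Ψ`, `R` on `{Ψ = c}`.) [cite: AkbulutOzbagci2001, Thm. 5 (proof, first step)]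
[cite: Etnyre2006, Lemma 3.3 and Thm. 5.6] -/
theorem palf_conclusion_of_flatReebModel
    (hF1 : ∀ z, Ψ z = c → 0 < -(fderiv ℝ Ψ z (stdComplexStructure (R z))))
    (hF2 : ∀ z, Ψ z = c → ∀ v, fderiv ℝ Ψ z v = 0 →
      extDeriv (dComplexFlat stdComplexStructure Ψ) z ![R z, v] = 0)
    (hF3 : ∀ z, Ψ z = c → w g z ≠ 0 → 0 < (conj (w g z) * fderiv ℝ (w g) z (R z)).im)
    (hF4 : ∀ z, Ψ z = c → w g z = 0 → ∀ v, fderiv ℝ Ψ z v = 0 → fderiv ℝ (w g) z v = 0 →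
      ∃ t : ℝ, v = t • R z)
    (hF5 : ∀ z, Ψ z = c → w g z = 0 → ∀ e₁ e₂ : E4, fderiv ℝ Ψ z e₁ = 0 → fderiv ℝ Ψ z e₂ = 0 →
      0 < (conj (fderiv ℝ (w g) z e₁) * fderiv ℝ (w g) z e₂).im →
      0 < -(extDeriv (dComplexFlat stdComplexStructure Ψ) z ![e₁, e₂]))
    {ι : Type} [Finite ι] [IsEmpty ι] (h : ι → HandleAttachingMap 3 2 (Base g))
    {X : Type} [TopologicalSpace X] [T2Space X] [ChartedSpace (EuclideanHalfSpace 4) X]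
    [IsManifold (𝓡∂ 4) ∞ X] [CompactSpace X]
    (D : MultiAttachmentData h (𝓡∂ 4) X) (bX : BoundaryData (𝓡∂ 4) X (𝓡 3))
    (ob : OpenBook bX.carrier) (hK : IsKasOpenBookOf g h D bX.incl ob) :
    ∃ (S' : SteinStructure X) (α : MForm (𝓡 3) bX.carrier ℝ 1),
      ob.IsGirouxForm (boundaryPlaneField S'.J bX) α ∧
      ∀ (y : bX.carrier) (a : ↥(coresComplement h)) (u : Fin 3 → E3) (v : Fin 3 → E4),
        bX.incl y = D.jA a →
        (∀ k, mfderiv (𝓡 3) (𝓡∂ 4) bX.incl y (u k) = mfderiv (𝓡∂ 4) (𝓡∂ 4) D.jA a (v k)) →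
        IsPosBdryFrame h a v →
        0 < wedge₁₂ (α y) (mextDeriv α y) (u 0) (u 1) (u 2) := by
  refine palf_conclusion_of_model (X₀ := RegularSublevel hΨ) (D₀ := flatModelData g hΨ e h)
    (bX₀ := RegularSublevel.boundaryData hΨ) (fun i => isEmptyElim i)
    (isKasOpenBookOf_flatModel g hΨ e h) hK ⟨S, S.boundaryContactForm _, ?_, ?_⟩
  · exact S.isGirouxForm_boundaryContactForm_of_reebField (RegularSublevel.boundaryData hΨ)
      (flatOB g hΨ e) (reebLift hΨ R)
      (boundaryContactForm_reebLift_pos hΨ R hF0 S hSJ hSφ hF1)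
      (mextDeriv_boundaryContactForm_reebLift hΨ R hF0 S hSJ hSφ hF2)
      (fun y hy => angularDeriv_reebLift_pos g hΨ e Φ he hw R hF0 hF3 y hy)
      (coreTangent_eq_smul_reebLift g hΨ e Φ he hw R hF0 hF4)
      (mextDeriv_boundaryContactForm_discFrame_pos g hΨ e Φ he hw R S hSJ hSφ hF4 hF5)
  · intro y a u v hya huv hfr
    obtain ⟨bJ, n, hbJ, hn, hdet'⟩ :=
      orientation_flatModel g hΨ e Φ he S hSJ hSφ hle heq hdet h y a u v hya huv hfr
    exact (S.wedge₁₂_boundaryContactForm_pos_iff (RegularSublevel.boundaryData hΨ) y hbJ hn u).2 hdet'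


/-! ### §9 The meridional positivity (F5) is automatic

At a binding point the frame `(-J₀R, R, L e₁, L e₂)` — outward vector, Reeb vector, meridional
frame — is positive for the complex orientation of `ℂ²`: in the complex coframe `(λ, dw)`
(`λ` complementary to the `ℂ`-linear `dw`, `dw(R) = 0`, `dw(L e₁) = a`, `dw(L e₂) = i a`) it
reads `((-iλR, 0), (λR, 0), (λ e₁, a), (λ e₂, i a))`, block triangular of determinant
`|λR|² a² > 0`.  Since the canonical boundary form of a Stein domain has `β ∧ dβ > 0` exactly on
complex-positive frames (`SteinStructure.wedge₁₂_boundaryContactForm_pos_iff`,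
`SteinBoundaryContactPositive.lean`) and `ι_R dβ = 0`, `β(R) > 0`, this gives `dβ(e₁, e₂) > 0`
with no hypothesis (F5). -/

section ComplexFrame

/-- `J₀ (a, b) = (i a, i b)` in complex coordinates. [folklore] -/
theorem stdComplexStructure_mk (a b : ℂ) : stdComplexStructure (LefschetzBase.mk a b) = LefschetzBase.mk (I * a) (I * b) := by
  ext i
  fin_cases i <;> simp [LefschetzBase.mk]

/-- `-(a, b) = (-a, -b)` in complex coordinates. [folklore] -/
theorem neg_mk (a b : ℂ) : -(LefschetzBase.mk a b) = LefschetzBase.mk (-a) (-b) := by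
  ext i
  fin_cases i <;> simp [LefschetzBase.mk]

/-- **A `ℂ`-linear functional on `ℂ²` is `α x + β y`** with `α = ℓ(1, 0)`, `β = ℓ(0, 1)`.
[folklore] -/
theorem clm_apply_eq_of_J (ℓ : E4 →L[ℝ] ℂ) (hℓ : ∀ v, ℓ (stdComplexStructure v) = I * ℓ v)
    (v : E4) : ℓ v = ℓ (LefschetzBase.mk 1 0) * cx v + ℓ (LefschetzBase.mk 0 1) * cy v := by
  have hv : v = (cx v).re • LefschetzBase.mk 1 0 + (cx v).im • stdComplexStructure (LefschetzBase.mk 1 0) +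
      ((cy v).re • LefschetzBase.mk 0 1 + (cy v).im • stdComplexStructure (LefschetzBase.mk 0 1)) := by
    rw [stdComplexStructure_mk, stdComplexStructure_mk]
    ext i
    fin_cases i <;> simp [LefschetzBase.mk, cx, cy]
  conv_lhs => rw [hv]
  simp only [map_add, map_smul, hℓ, Complex.real_smul]
  apply Complex.ext <;> simp <;> ring

/-- The complementary functional `λ = -β̄ x + ᾱ y`. [folklore] -/
def coframeL (α β : ℂ) : E4 →L[ℝ] ℂ :=
  (ContinuousLinearMap.mul ℝ ℂ (-(conj β))).comp cxL + (ContinuousLinearMap.mul ℝ ℂ (conj α)).comp cyL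

/-- Unfolding `coframeL`. [folklore] -/
@[simp] theorem coframeL_apply (α β : ℂ) (v : E4) :
    coframeL α β v = -(conj β) * cx v + conj α * cy v := by
  simp [coframeL]

/-- **The complex coframe map `v ↦ (λ v, ℓ v) ∈ ℂ²`** as a real-linear endomorphism of `ℝ⁴`.
[folklore] -/
def coframeMap (ℓ lam : E4 →L[ℝ] ℂ) : E4 →ₗ[ℝ] E4 where
  toFun v := LefschetzBase.mk (lam v) (ℓ v)
  map_add' u v := by
    ext i
    fin_cases i <;> simp [LefschetzBase.mk, map_add]
  map_smul' t v := by
    ext i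
    fin_cases i <;> simp [LefschetzBase.mk, map_smul]

/-- Unfolding `coframeMap`. [folklore] -/
@[simp] theorem coframeMap_apply (ℓ lam : E4 →L[ℝ] ℂ) (v : E4) :
    coframeMap ℓ lam v = LefschetzBase.mk (lam v) (ℓ v) := rfl

/-- **An explicit block-triangular `4 × 4` determinant**:
`det((-ic, 0), (c, 0), (l₀, a), (l₁, ia)) = |c|² a²`. [folklore] -/
theorem det4_mk_block (c l₀ l₁ : ℂ) (a : ℝ) :
    det4 (LefschetzBase.mk (-(I * c)) 0) (LefschetzBase.mk c 0) (LefschetzBase.mk l₀ (a : ℂ)) (LefschetzBase.mk l₁ ((a : ℂ) * I)) =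
      Complex.normSq c * a ^ 2 := by
  simp [det4, Matrix.det_succ_row_zero, Fin.sum_univ_succ, LefschetzBase.mk, Matrix.of_apply,
    Fin.succAbove, Complex.normSq_apply]
  ring

/-- **Positivity of the frame `(-J₀R, R, f₀, f₁)`** for a `ℂ`-linear functional `ℓ ≠ 0` on
`ℂ²` with `ℓ R = 0`, `R ≠ 0`, `ℓ f₀ = a > 0`, `ℓ f₁ = i a`. [folklore] -/
theorem det4_pos_of_complexFrame (ℓ : E4 →L[ℝ] ℂ)
    (hℓ : ∀ v, ℓ (stdComplexStructure v) = I * ℓ v) {Rz f₀ f₁ : E4} (hR : Rz ≠ 0)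
    (hRℓ : ℓ Rz = 0) {a : ℝ} (ha : 0 < a) (hf₀ : ℓ f₀ = a) (hf₁ : ℓ f₁ = a * I) :
    0 < det4 (-(stdComplexStructure Rz)) Rz f₀ f₁ := by
  set α : ℂ := ℓ (LefschetzBase.mk 1 0) with hα
  set β : ℂ := ℓ (LefschetzBase.mk 0 1) with hβ
  have hℓv : ∀ v, ℓ v = α * cx v + β * cy v := clm_apply_eq_of_J ℓ hℓ
  have hαβ : 0 < Complex.normSq α + Complex.normSq β := by
    by_contra h0
    push Not at h0
    have h1 : Complex.normSq α = 0 := by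
      have := Complex.normSq_nonneg α; have := Complex.normSq_nonneg β; linarith
    have h2 : Complex.normSq β = 0 := by
      have := Complex.normSq_nonneg α; have := Complex.normSq_nonneg β; linarith
    rw [Complex.normSq_eq_zero] at h1 h2
    have : ℓ f₀ = 0 := by rw [hℓv, h1, h2]; ring
    rw [hf₀] at this
    exact ha.ne' (by exact_mod_cast this)
  set lam := coframeL α β with hlam
  have hlamJ : ∀ v, lam (stdComplexStructure v) = I * lam v := by
    intro v
    rw [hlam, coframeL_apply, coframeL_apply, LefschetzBaseSteinModel.cx_J,
      LefschetzBaseSteinModel.cy_J]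
    ring
  set M := coframeMap ℓ lam with hM
  -- `M` commutes with `J₀`
  have hMJ : ∀ v, M (stdComplexStructure v) = stdComplexStructure (M v) := by
    intro v
    rw [hM, coframeMap_apply, coframeMap_apply, hlamJ, hℓ, stdComplexStructure_mk]
  -- `M` is injective
  have hMinj : Injective M := by
    intro u v huv
    have h1 : lam u = lam v := by
      have := congrArg cx huv; simpa [hM] using this
    have h2 : ℓ u = ℓ v := by
      have := congrArg cy huv; simpa [hM] using this
    rw [hlam, coframeL_apply, coframeL_apply] at h1
    rw [hℓv, hℓv] at h2
    -- solve the `2 × 2` complex system for `(cx u - cx v, cy u - cy v)`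
    have hξ : (Complex.normSq α + Complex.normSq β : ℂ) * (cx u - cx v) = 0 := by
      rw [Complex.normSq_eq_conj_mul_self, Complex.normSq_eq_conj_mul_self]
      linear_combination (conj α) * h2 - β * h1
    have hη : (Complex.normSq α + Complex.normSq β : ℂ) * (cy u - cy v) = 0 := by
      rw [Complex.normSq_eq_conj_mul_self, Complex.normSq_eq_conj_mul_self]
      linear_combination (conj β) * h2 + α * h1
    have hne : (Complex.normSq α + Complex.normSq β : ℂ) ≠ 0 := by
      exact_mod_cast hαβ.ne'
    have hx : cx u = cx v := by
      have := (mul_eq_zero.1 hξ).resolve_left hne; exact sub_eq_zero.1 this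
    have hy : cy u = cy v := by
      have := (mul_eq_zero.1 hη).resolve_left hne; exact sub_eq_zero.1 this
    rw [← mk_cx_cy u, ← mk_cx_cy v, hx, hy]
  -- hence `det M > 0`
  have hdetM : 0 < LinearMap.det M := by
    have := ComplexStructure.det_pos_of_commute
      (⟨((stdComplexStructure : E4 →L[ℝ] E4) : E4 →ₗ[ℝ] E4), stdComplexStructure_sq⟩ :
        ComplexStructure E4)
      (LinearEquiv.ofInjectiveEndo M hMinj) (fun v => hMJ v)
    have hco : ((LinearEquiv.ofInjectiveEndo M hMinj : E4 ≃ₗ[ℝ] E4) : E4 →ₗ[ℝ] E4) = M := by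
      ext v; rfl
    rw [hco] at this
    exact this
  -- `λ R ≠ 0`
  have hc : lam Rz ≠ 0 := by
    intro h0
    apply hR
    apply hMinj
    rw [map_zero, hM, coframeMap_apply, h0, hRℓ]
    ext i; fin_cases i <;> simp [LefschetzBase.mk]
  -- transform the determinant
  have htrans := det4_linearMap M (-(stdComplexStructure Rz)) Rz f₀ f₁
  have e1 : M (-(stdComplexStructure Rz)) = LefschetzBase.mk (-(I * lam Rz)) 0 := by
    rw [map_neg, hMJ, hM, coframeMap_apply, hRℓ, stdComplexStructure_mk, neg_mk, mul_zero, neg_zero]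
  have e2 : M Rz = LefschetzBase.mk (lam Rz) 0 := by rw [hM, coframeMap_apply, hRℓ]
  have e3 : M f₀ = LefschetzBase.mk (lam f₀) (a : ℂ) := by rw [hM, coframeMap_apply, hf₀]
  have e4 : M f₁ = LefschetzBase.mk (lam f₁) ((a : ℂ) * I) := by rw [hM, coframeMap_apply, hf₁]
  rw [e1, e2, e3, e4, det4_mk_block] at htrans
  have hprod : 0 < LinearMap.det M * det4 (-(stdComplexStructure Rz)) Rz f₀ f₁ := by
    rw [← htrans]
    exact mul_pos (Complex.normSq_pos.2 hc) (by positivity)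
  exact (pos_iff_pos_of_mul_pos hprod).1 hdetM

end ComplexFrame

omit [CompactSpace (RegularSublevel hΨ)] in
/-- The determinant in the adapted basis `Dι⁻¹(e₀, …, e₃)` of a frame `(Dι⁻¹ n, d(incl_∂) u₀,
d(incl_∂) u₁, d(incl_∂) u₂)` is `det4(n, L u₀, L u₁, L u₂)`. [folklore] -/
theorem det_flatBasis (y : (RegularSublevel.boundaryData hΨ).carrier) (n : E4) (u : Fin 3 → E3) :
    ((PiLp.basisFun 2 ℝ (Fin 4)).map ((inclDeriv hΨ y.1).symm : E4 ≃L[ℝ] E4).toLinearEquiv).det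
      ![(inclDeriv hΨ y.1).symm n,
        mfderiv (𝓡 3) (𝓡∂ 4) (RegularSublevel.boundaryData hΨ).incl y (u 0),
        mfderiv (𝓡 3) (𝓡∂ 4) (RegularSublevel.boundaryData hΨ).incl y (u 1),
        mfderiv (𝓡 3) (𝓡∂ 4) (RegularSublevel.boundaryData hΨ).incl y (u 2)] =
      det4 n (bdDeriv hΨ y (u 0)) (bdDeriv hΨ y (u 1)) (bdDeriv hΨ y (u 2)) := by
  rw [det_map_symm]
  show det4 (inclDeriv hΨ y.1 ((inclDeriv hΨ y.1).symm n)) (bdDeriv hΨ y (u 0)) (bdDeriv hΨ y (u 1))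
    (bdDeriv hΨ y (u 2)) = _
  rw [ContinuousLinearEquiv.apply_symm_apply]

/-- `a ∧ b (u, v, w) = a(u) b(v, w)` when `ι_u b` vanishes on `v` and `w`. [folklore] -/
theorem wedge₁₂_of_inner_zero (a : E3 [⋀^Fin 1]→L[ℝ] ℝ) (b : E3 [⋀^Fin 2]→L[ℝ] ℝ) (u v w : E3)
    (hw : b ![u, w] = 0) (hv : b ![u, v] = 0) : wedge₁₂ a b u v w = a ![u] * b ![v, w] := by
  rw [wedge₁₂, hw, hv, mul_zero, mul_zero, sub_zero, add_zero]

omit [CompactSpace (RegularSublevel hΨ)] in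
include he hw in
/-- **At a binding point `dw(R) = 0`**: `dw ∘ L : ℝ³ → ℂ` has a kernel vector, which lies in
`ker dΨ ∩ ker dw ⊆ ℝ R` by (F4). [folklore] -/
theorem fderiv_w_reeb_eq_zero
    (hF4 : ∀ z, Ψ z = c → w g z = 0 → ∀ v, fderiv ℝ Ψ z v = 0 → fderiv ℝ (w g) z v = 0 →
      ∃ t : ℝ, v = t • R z)
    (i : Fin (flatOB g hΨ e).k) (x : Metric.sphere (0 : E2) 1) :
    fderiv ℝ (w g) (bdPt hΨ ((flatOB g hΨ e).tube i (x, 0))) (R (bdPt hΨ ((flatOB g hΨ e).tube i (x, 0)))) = 0 := by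
  set y₀ := (flatOB g hΨ e).tube i (x, 0) with hy₀
  set T : E3 →ₗ[ℝ] ℂ := (((fderiv ℝ (w g) (bdPt hΨ y₀)).comp (bdDeriv hΨ y₀) : E3 →L[ℝ] ℂ) :
    E3 →ₗ[ℝ] ℂ) with hT
  have hker : LinearMap.ker T ≠ ⊥ := by
    apply LinearMap.ker_ne_bot_of_finrank_lt
    rw [Complex.finrank_real_complex, finrank_euclideanSpace_fin]
    norm_num
  obtain ⟨u, hu, hu0⟩ := Submodule.exists_mem_ne_zero_of_ne_bot hker
  have hTu : fderiv ℝ (w g) (bdPt hΨ y₀) (bdDeriv hΨ y₀ u) = 0 := hu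
  obtain ⟨t, ht⟩ := hF4 _ (apply_bdPt hΨ y₀) (w_bdPt_tube_core g hΨ e Φ he hw i x) _
    (fderiv_apply_bdDeriv hΨ y₀ u) hTu
  have ht0 : t ≠ 0 := by
    rintro rfl
    rw [zero_smul] at ht
    exact hu0 (bdDeriv_injective hΨ y₀ (by rw [ht, map_zero]))
  have := congrArg (fun v => t⁻¹ • v) ht
  simp only [smul_smul, inv_mul_cancel₀ ht0, one_smul] at this
  rw [← this, map_smul, hTu, smul_zero]

include he hw hF0 hSJ hSφ in
/-- **(R5) without (F5): `dβ_S(e₁, e₂) > 0` on the meridional frame**, from (F0), (F1), (F2),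
(F4) and the positivity of the Stein boundary contact form on complex-positive frames.
[cite: Etnyre2006, Lemma 3.3] -/
theorem mextDeriv_boundaryContactForm_discFrame_pos'
    (hF1 : ∀ z, Ψ z = c → 0 < -(fderiv ℝ Ψ z (stdComplexStructure (R z))))
    (hF2 : ∀ z, Ψ z = c → ∀ v, fderiv ℝ Ψ z v = 0 →
      extDeriv (dComplexFlat stdComplexStructure Ψ) z ![R z, v] = 0)
    (hF4 : ∀ z, Ψ z = c → w g z = 0 → ∀ v, fderiv ℝ Ψ z v = 0 → fderiv ℝ (w g) z v = 0 →
      ∃ t : ℝ, v = t • R z)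
    (i : Fin (flatOB g hΨ e).k) (x : Metric.sphere (0 : E2) 1) :
    0 < mextDeriv (S.boundaryContactForm (RegularSublevel.boundaryData hΨ))
      ((flatOB g hΨ e).tube i (x, 0)) ![(flatOB g hΨ e).discFrame i x 0, (flatOB g hΨ e).discFrame i x 1] := by
  set y₀ := (flatOB g hΨ e).tube i (x, 0) with hy₀
  set z := bdPt hΨ y₀ with hz
  set Rz := R z with hRz
  have hΨz : Ψ z = c := apply_bdPt hΨ y₀
  -- the data at the binding point
  have hRne : Rz ≠ 0 := by
    intro h0
    have := hF1 z hΨz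
    rw [← hRz, h0, map_zero, map_zero, neg_zero] at this
    exact lt_irrefl _ this
  obtain ⟨a, ha0, hf₀, hf₁⟩ := fderiv_w_bdDeriv_discFrame g hΨ e Φ he hw i x
  have hane := fderiv_w_bdDeriv_discFrame_ne_zero g hΨ e Φ he hw R hF4 i x
  rw [hf₀] at hane
  have ha : 0 < a := lt_of_le_of_ne ha0 (fun h => hane (by rw [← h]; simp))
  have hℓJ : ∀ v, fderiv ℝ (w g) z (stdComplexStructure v) = I * fderiv ℝ (w g) z v := by
    intro v; rw [LefschetzBaseSteinModel.fderiv_w, LefschetzBaseSteinModel.wD_J]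
  have hRw : fderiv ℝ (w g) z Rz = 0 := fderiv_w_reeb_eq_zero g hΨ e Φ he hw R hF4 i x
  have hdet4 : 0 < det4 (-(stdComplexStructure Rz)) Rz
      (bdDeriv hΨ y₀ ((flatOB g hΨ e).discFrame i x 0))
      (bdDeriv hΨ y₀ ((flatOB g hΨ e).discFrame i x 1)) :=
    det4_pos_of_complexFrame (fderiv ℝ (w g) z) hℓJ hRne hRw ha hf₀ hf₁
  -- the wedge is positive on the frame `(R, e₁, e₂)`
  set D : E4 ≃L[ℝ] E4 := inclDeriv hΨ y₀.1 with hD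
  have hn : 0 < S.dφ ((RegularSublevel.boundaryData hΨ).incl y₀) (D.symm (-(stdComplexStructure Rz))) := by
    have : S.dφ y₀.1 (D.symm (-(stdComplexStructure Rz))) =
        fderiv ℝ Ψ z (-(stdComplexStructure Rz)) := by
      rw [dφ_flat hΨ S hSφ, hD, ContinuousLinearEquiv.apply_symm_apply]
      rfl
    rw [show (RegularSublevel.boundaryData hΨ).incl y₀ = y₀.1 from rfl, this, map_neg]
    exact hF1 z hΨz
  have hwedge := (S.wedge₁₂_boundaryContactForm_pos_iff (RegularSublevel.boundaryData hΨ) y₀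
    (isAdaptedBasis_flat hΨ S hSJ y₀.1) hn
    ![reebLift hΨ R y₀, (flatOB g hΨ e).discFrame i x 0, (flatOB g hΨ e).discFrame i x 1]).2 (by
      rw [det_flatBasis]
      show 0 < det4 (-(stdComplexStructure Rz)) (bdDeriv hΨ y₀ (reebLift hΨ R y₀))
        (bdDeriv hΨ y₀ ((flatOB g hΨ e).discFrame i x 0))
        (bdDeriv hΨ y₀ ((flatOB g hΨ e).discFrame i x 1))
      rw [bdDeriv_reebLift hΨ R hF0 y₀]
      exact hdet4)
  -- expand the wedge: the `ι_R dβ` terms vanish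
  have hι := mextDeriv_boundaryContactForm_reebLift hΨ R hF0 S hSJ hSφ hF2 y₀
  have hβR := boundaryContactForm_reebLift_pos hΨ R hF0 S hSJ hSφ hF1 y₀
  have key := wedge₁₂_of_inner_zero (S.boundaryContactForm (RegularSublevel.boundaryData hΨ) y₀)
    (mextDeriv (S.boundaryContactForm (RegularSublevel.boundaryData hΨ)) y₀)
    (reebLift hΨ R y₀) ((flatOB g hΨ e).discFrame i x 0) ((flatOB g hΨ e).discFrame i x 1)
    (hι _) (hι _)
  have h3 : 0 < S.boundaryContactForm (RegularSublevel.boundaryData hΨ) y₀ ![reebLift hΨ R y₀] *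
      mextDeriv (S.boundaryContactForm (RegularSublevel.boundaryData hΨ)) y₀
        ![(flatOB g hΨ e).discFrame i x 0, (flatOB g hΨ e).discFrame i x 1] :=
    hwedge.trans_eq key
  exact pos_of_mul_pos_right h3 hβR.le

include he hw hle heq hdet hF0 hSJ hSφ in
/-- **PALF ⇒ Stein with supported Kas open book, handle-free case, from a flat Reeb-compatible
Stein model of the base — without the meridional hypothesis (F5)**, which is automatic (§9).
[cite: AkbulutOzbagci2001, Thm. 5 (proof, first step)] [cite: Etnyre2006, Lemma 3.3 and Thm. 5.6] -/
theorem palf_conclusion_of_flatReebModel'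
    (hF1 : ∀ z, Ψ z = c → 0 < -(fderiv ℝ Ψ z (stdComplexStructure (R z))))
    (hF2 : ∀ z, Ψ z = c → ∀ v, fderiv ℝ Ψ z v = 0 →
      extDeriv (dComplexFlat stdComplexStructure Ψ) z ![R z, v] = 0)
    (hF3 : ∀ z, Ψ z = c → w g z ≠ 0 → 0 < (conj (w g z) * fderiv ℝ (w g) z (R z)).im)
    (hF4 : ∀ z, Ψ z = c → w g z = 0 → ∀ v, fderiv ℝ Ψ z v = 0 → fderiv ℝ (w g) z v = 0 →
      ∃ t : ℝ, v = t • R z)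
    {ι : Type} [Finite ι] [IsEmpty ι] (h : ι → HandleAttachingMap 3 2 (Base g))
    {X : Type} [TopologicalSpace X] [T2Space X] [ChartedSpace (EuclideanHalfSpace 4) X]
    [IsManifold (𝓡∂ 4) ∞ X] [CompactSpace X]
    (D : MultiAttachmentData h (𝓡∂ 4) X) (bX : BoundaryData (𝓡∂ 4) X (𝓡 3))
    (ob : OpenBook bX.carrier) (hK : IsKasOpenBookOf g h D bX.incl ob) :
    ∃ (S' : SteinStructure X) (α : MForm (𝓡 3) bX.carrier ℝ 1),
      ob.IsGirouxForm (boundaryPlaneField S'.J bX) α ∧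
      ∀ (y : bX.carrier) (a : ↥(coresComplement h)) (u : Fin 3 → E3) (v : Fin 3 → E4),
        bX.incl y = D.jA a →
        (∀ k, mfderiv (𝓡 3) (𝓡∂ 4) bX.incl y (u k) = mfderiv (𝓡∂ 4) (𝓡∂ 4) D.jA a (v k)) →
        IsPosBdryFrame h a v →
        0 < wedge₁₂ (α y) (mextDeriv α y) (u 0) (u 1) (u 2) := by
  refine palf_conclusion_of_model (X₀ := RegularSublevel hΨ) (D₀ := flatModelData g hΨ e h)
    (bX₀ := RegularSublevel.boundaryData hΨ) (fun i => isEmptyElim i)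
    (isKasOpenBookOf_flatModel g hΨ e h) hK ⟨S, S.boundaryContactForm _, ?_, ?_⟩
  · exact S.isGirouxForm_boundaryContactForm_of_reebField (RegularSublevel.boundaryData hΨ)
      (flatOB g hΨ e) (reebLift hΨ R)
      (boundaryContactForm_reebLift_pos hΨ R hF0 S hSJ hSφ hF1)
      (mextDeriv_boundaryContactForm_reebLift hΨ R hF0 S hSJ hSφ hF2)
      (fun y hy => angularDeriv_reebLift_pos g hΨ e Φ he hw R hF0 hF3 y hy)
      (coreTangent_eq_smul_reebLift g hΨ e Φ he hw R hF0 hF4)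
      (mextDeriv_boundaryContactForm_discFrame_pos' g hΨ e Φ he hw R hF0 S hSJ hSφ hF1 hF2 hF4)
  · intro y a u v hya huv hfr
    obtain ⟨bJ, n, hbJ, hn, hdet'⟩ :=
      orientation_flatModel g hΨ e Φ he S hSJ hSφ hle heq hdet h y a u v hya huv hfr
    exact (S.wedge₁₂_boundaryContactForm_pos_iff (RegularSublevel.boundaryData hΨ) y hbJ hn u).2 hdet'


/-! ### §10 The Levi-gradient Reeb field: (F0)–(F2) are automatic

For `Ψ` with positive definite flat Levi form `h_z(u, v) = D²Ψ_z(u, v) + D²Ψ_z(J₀u, J₀v)` on the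
level and `G` its Levi gradient there (`h(G, ·) = dΨ`), the field `R = J₀ G` satisfies (F0)
`dΨ(J₀G) = h(G, J₀G) = 0`, (F1) `-dΨ(J₀J₀G) = h(G, G) > 0`, (F2)
`dd^ℂΨ(J₀G, v) = D²Ψ(J₀G, J₀v) + D²Ψ(v, G) = h(G, v) = dΨ(v) = 0` on `ker dΨ`
(Cieliebak–Eliashberg 2012, Ch. 2; `SublevelSteinReebGradient.lean` proves the same clauses on
the boundary manifold).  So the base case needs, besides the model and its identification, only
the page condition (F3) `Re(w̄ · dw(G)) > 0` off the binding and the binding condition (F4). -/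

omit [CompactSpace (RegularSublevel hΨ)] in
include hΨ in
/-- `dΨ ≠ 0` at every point of the level. [folklore] -/
theorem fderiv_ne_zero_of_level {z : E4} (hz : Ψ z = c) : fderiv ℝ Ψ z ≠ 0 :=
  fderiv_bdPt_ne_zero hΨ ⟨RegularSublevel.mk hΨ z hz.le,
    (RegularSublevel.mem_boundary_iff hΨ _).2 hz⟩

include he hw hle heq hdet hSJ hSφ in
/-- **PALF ⇒ Stein with supported Kas open book, handle-free case, from a Levi-positive flat
model with a page-compatible Levi gradient.**  As `palf_conclusion_of_flatReebModel'` for the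
field `R = J₀ G`, `G` the Levi gradient of `Ψ` on the level (`h(G, ·) = dΨ`,
`h(u, v) = D²Ψ(u, v) + D²Ψ(J₀u, J₀v)` positive definite there): (F0)–(F2) hold identically, and the
remaining hypotheses are the page condition `Re(w̄ · dw(G)) > 0` where `w ≠ 0` and the binding
condition (where `w = 0`, `ker dΨ ∩ ker dw ⊆ ℝ J₀G`).
[cite: AkbulutOzbagci2001, Thm. 5 (proof, first step)] [cite: Etnyre2006, Lemma 3.3 and Thm. 5.6]
[cite: CieliebakEliashberg2012, Ch. 2] -/
theorem palf_conclusion_of_leviReebModel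
    (hlevi : ∀ z, Ψ z = c → ∀ u : E4, u ≠ 0 →
      0 < fderiv ℝ (fderiv ℝ Ψ) z u u +
        fderiv ℝ (fderiv ℝ Ψ) z (stdComplexStructure u) (stdComplexStructure u))
    (G : E4 → E4)
    (hG : ∀ z, Ψ z = c → ∀ v, fderiv ℝ (fderiv ℝ Ψ) z (G z) v +
      fderiv ℝ (fderiv ℝ Ψ) z (stdComplexStructure (G z)) (stdComplexStructure v) = fderiv ℝ Ψ z v)
    (hpage : ∀ z, Ψ z = c → w g z ≠ 0 → 0 < (conj (w g z) * fderiv ℝ (w g) z (G z)).re)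
    (hbind : ∀ z, Ψ z = c → w g z = 0 → ∀ v, fderiv ℝ Ψ z v = 0 → fderiv ℝ (w g) z v = 0 →
      ∃ t : ℝ, v = t • stdComplexStructure (G z))
    {ι : Type} [Finite ι] [IsEmpty ι] (h : ι → HandleAttachingMap 3 2 (Base g))
    {X : Type} [TopologicalSpace X] [T2Space X] [ChartedSpace (EuclideanHalfSpace 4) X]
    [IsManifold (𝓡∂ 4) ∞ X] [CompactSpace X]
    (D : MultiAttachmentData h (𝓡∂ 4) X) (bX : BoundaryData (𝓡∂ 4) X (𝓡 3))
    (ob : OpenBook bX.carrier) (hK : IsKasOpenBookOf g h D bX.incl ob) :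
    ∃ (S' : SteinStructure X) (α : MForm (𝓡 3) bX.carrier ℝ 1),
      ob.IsGirouxForm (boundaryPlaneField S'.J bX) α ∧
      ∀ (y : bX.carrier) (a : ↥(coresComplement h)) (u : Fin 3 → E3) (v : Fin 3 → E4),
        bX.incl y = D.jA a →
        (∀ k, mfderiv (𝓡 3) (𝓡∂ 4) bX.incl y (u k) = mfderiv (𝓡∂ 4) (𝓡∂ 4) D.jA a (v k)) →
        IsPosBdryFrame h a v →
        0 < wedge₁₂ (α y) (mextDeriv α y) (u 0) (u 1) (u 2) := by
  have hΨs : ContDiff ℝ ∞ Ψ := contDiff_of_isRegularLevel hΨ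
  have hsymm : ∀ z (u v : E4), fderiv ℝ (fderiv ℝ Ψ) z u v = fderiv ℝ (fderiv ℝ Ψ) z v u :=
    fun z u v => ((hΨs.of_le (by norm_cast)).contDiffAt (x := z)).isSymmSndFDerivAt
      (n := 2) (by simp) u v
  have hJ : ∀ v : E4, stdComplexStructure (stdComplexStructure v) = -v := stdComplexStructure_sq
  -- `G ≠ 0` on the level
  have hG0 : ∀ z, Ψ z = c → G z ≠ 0 := by
    intro z hz h0
    apply fderiv_ne_zero_of_level hΨ hz
    ext v
    have := hG z hz v
    rw [h0, map_zero, map_zero, zero_apply, map_zero, zero_apply, zero_add] at this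
    exact this.symm
  refine palf_conclusion_of_flatReebModel' g hΨ e Φ he hw (fun z => stdComplexStructure (G z))
    ?_ S hSJ hSφ hle heq hdet ?_ ?_ ?_ hbind h D bX ob hK
  · -- (F0) `dΨ(J₀G) = h(G, J₀G) = 0`
    intro z hz
    have h1 := hG z hz (stdComplexStructure (G z))
    rw [hJ, map_neg, hsymm z (stdComplexStructure (G z)) (G z)] at h1
    linarith
  · -- (F1) `-dΨ(J₀J₀G) = dΨ(G) = h(G, G) > 0`
    intro z hz
    rw [hJ, map_neg, neg_neg, ← hG z hz (G z)]
    exact hlevi z hz _ (hG0 z hz)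
  · -- (F2) `dd^ℂΨ(J₀G, v) = h(G, v) = dΨ(v) = 0`
    intro z hz v hv
    rw [extDeriv_dComplexFlat_apply stdComplexStructure hΨs, hJ, map_neg, sub_neg_eq_add,
      hsymm z v (G z), add_comm, hG z hz v, hv]
  · -- (F3) `Im(w̄ dw(J₀G)) = Re(w̄ dw(G))`
    intro z hz hw0
    rw [LefschetzBaseSteinModel.fderiv_w, LefschetzBaseSteinModel.wD_J, ← mul_assoc,
      mul_comm (conj (w g z)) I, mul_assoc, Complex.I_mul_im, ← LefschetzBaseSteinModel.fderiv_w]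
    exact hpage z hz hw0

/-- **The named fact `palf_stein_supportedByBoundaryOpenBook` for HANDLE-FREE families, from
one Levi-positive flat model of the base per genus with a page-compatible Levi gradient.**
Hypothesis `H g`: the data of `LefschetzBaseModelSteinOrient.exists_steinStructure_model_orient`
(a compact regular sublevel Stein model `{Ψ ≤ c}` in normal form, identified with `Base g` over a
page-preserving diffeomorphism of `ℂ²` with positive Jacobian, Levi-positive on the level)
together with a Levi gradient `G` of `Ψ` on `{Ψ = c}` satisfying the page condition
`Re(w̄ · dw(G)) > 0` off `{w = 0}` and the binding condition on `{w = 0}`.  Conclusion: the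
statement of the named fact for every `ι` with `IsEmpty ι` (Torisu's theorem: the trivial open
book of `∂(F_{g,1} × D²)` supports its Stein fillable contact structure).
[cite: AkbulutOzbagci2001, Thm. 5 (proof, first step)] [cite: Torisu2000] [cite: Etnyre2006, Thm. 5.6] -/
theorem palf_stein_supportedByBoundaryOpenBook_of_isEmpty_of_leviModels
    (H : ∀ g : ℕ, ∃ (Ψ : E4 → ℝ) (c : ℝ) (hΨ : IsRegularLevel (𝓡 4) Ψ c)
      (_ : CompactSpace (RegularSublevel hΨ))
      (Φ : E4 ≃ₘ⟮𝓘(ℝ, E4), 𝓘(ℝ, E4)⟯ E4) (e : Base g ≃ₘ⟮𝓡∂ 4, 𝓡∂ 4⟯ RegularSublevel hΨ)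
      (S : SteinStructure (RegularSublevel hΨ)) (G : E4 → E4),
      (∀ p, RegularSublevel.incl hΨ (e p) = Φ (RegularSublevel.incl (isRegularLevel_rho g) p)) ∧
      Φ '' (LefschetzBase.rho g ⁻¹' Iic (1 / 4)) = Ψ ⁻¹' Iic c ∧
      Φ '' (LefschetzBase.rho g ⁻¹' {1 / 4}) = Ψ ⁻¹' {c} ∧
      (∀ z, ∃ r : ℝ, 0 < r ∧ w g (Φ z) = (r : ℂ) * w g z) ∧
      (∀ z, 0 < LinearMap.det (fderiv ℝ Φ z : E4 →ₗ[ℝ] E4)) ∧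
      S.J = sublevelJ hΨ stdComplexStructure ∧ S.φ = sublevelPhi hΨ ∧
      (∀ z, Ψ z = c → ∀ u : E4, u ≠ 0 →
        0 < fderiv ℝ (fderiv ℝ Ψ) z u u +
          fderiv ℝ (fderiv ℝ Ψ) z (stdComplexStructure u) (stdComplexStructure u)) ∧
      (∀ z, Ψ z = c → ∀ v, fderiv ℝ (fderiv ℝ Ψ) z (G z) v +
        fderiv ℝ (fderiv ℝ Ψ) z (stdComplexStructure (G z)) (stdComplexStructure v) =
          fderiv ℝ Ψ z v) ∧
      (∀ z, Ψ z = c → w g z ≠ 0 → 0 < (conj (w g z) * fderiv ℝ (w g) z (G z)).re) ∧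
      (∀ z, Ψ z = c → w g z = 0 → ∀ v, fderiv ℝ Ψ z v = 0 → fderiv ℝ (w g) z v = 0 →
        ∃ t : ℝ, v = t • stdComplexStructure (G z)))
    (g : ℕ) (ι : Type) [Finite ι] [IsEmpty ι] (X : Type) [TopologicalSpace X] [T2Space X]
    [SecondCountableTopology X] [CompactSpace X] [ChartedSpace (EuclideanHalfSpace 4) X]
    [IsManifold (𝓡∂ 4) ∞ X] (h : ι → HandleAttachingMap 3 2 (Base g))
    (D : MultiAttachmentData h (𝓡∂ 4) X) (bX : BoundaryData (𝓡∂ 4) X (𝓡 3))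
    (ob : OpenBook bX.carrier) :
    (∀ i, ∃ c : ℂ, ‖c‖ = 1 ∧ ∀ θ, (h i).attachingCircle θ ∈ page g c) →
    (∀ i, shadow g (h i).attachingCircle (h i).continuous_attachingCircle ≠ 0) →
    (∀ i, pageTwisting g (h i).attachingCircle (h i).attachingFraming = -1) →
    IsKasOpenBookOf g h D bX.incl ob →
    ∃ (S : SteinStructure X) (α : Literature.Geometry.Kaehler.MForm (𝓡 3) bX.carrier ℝ 1),
      ob.IsGirouxForm (boundaryPlaneField S.J bX) α ∧
      ∀ (y : bX.carrier) (a : ↥(coresComplement h)) (u : Fin 3 → EuclideanSpace ℝ (Fin 3))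
        (v : Fin 3 → EuclideanSpace ℝ (Fin 4)),
        bX.incl y = D.jA a →
        (∀ k, mfderiv (𝓡 3) (𝓡∂ 4) bX.incl y (u k) = mfderiv (𝓡∂ 4) (𝓡∂ 4) D.jA a (v k)) →
        IsPosBdryFrame h a v →
        0 < wedge₁₂ (α y) (Literature.Geometry.Kaehler.mextDeriv α y) (u 0) (u 1) (u 2) := by
  intro _ _ _ hK
  obtain ⟨Ψ, c, hΨ, _, Φ, e, S, G, he, hle, heq, hw, hdet, hSJ, hSφ, hlevi, hG, hpage, hbind⟩ :=
    H g
  exact palf_conclusion_of_leviReebModel g hΨ e Φ he hw S hSJ hSφ hle heq hdet hlevi G hG hpage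
    hbind h D bX ob hK

end Model

end Literature.Geometry.Symplectic

end
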